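/-
Copyright (c) 2026. All rights reserved.
Released under Apache 2.0 license as described in the file LICENSE.
-/
import Literature.MathematicalPhysics.QuantumFieldTheory.Balaban1983to89.B4Lemma22L1Stair

/-!
# B4 Lemma 2.2 (2.17) ON THE WHOLE DIAGONAL `q = p ∈ [1,∞)` FOR `G_k(□,Ã)`, ALL THREE MEMBERS `n ≤ 1` — THE
`ℓ^p` BOOTSTRAP (SCHUR TEST AND `L^p` DUALITY IN PLACE OF RIESZ–THORIN)

[B4] = T. Bałaban, *(Higgs)₂,₃ quantum fields in a finite volume. III. Regularity and decay of lattice Green's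
functions*, Commun. Math. Phys. **89** (1983) 571–597 (bib key `Balaban1983RegularityDecay`).

## The printed step («» = quotation units, transcript-B4.md ll. 106–108, 161–167, 187)

Lemma 2.2, pp. 577–578: «and a constant c₂ depending on d, p₁, such that (2.17) ‖G_k(□,Ã)f‖_q,
‖D^η_{Ã,μ}G_k(□,Ã)f‖_q, ‖G_k(□,Ã)D^{η*}_{Ã,μ}f‖_q ≤ c₂‖f‖_p for 1 ≤ p, q ≤ ∞, satisfying the condition
1/p − 1/p₁ ≤ 1/q ≤ 1/p with p₁ > d.»  Proof, p. 581: «At first let us observe that V_k can be interpreted as a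
first order differential operator acting on a function on the right hand side of it.» … «Thus it is a first order
differential operator with small coefficients.» … «The inequality (2.17) is proved in the same way.» … «Lemma 2.2
in the case of a constant configuration A₀ is equivalent to the case of configuration A₀ = 0 by the same argument
with the gauge transformation as before.»; p. 583 (zero field): «For q = p = 1 we get it by duality argument,
i.e. using the fact that the space L^∞(□) is adjoint to L¹(□). The Riesz-Thorin Theorem implies it for arbitrary
q = p from [1,∞].»

## What this file certifies (kernel form; the lineage's typed objects)

The tree has (2.17), members `n ≤ 1`, for the lineage's `G_k(□,Ã)` (`B4Lemma22ReduceZero.greenA` at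
`Ã = constBond A₀ + A'`, boxes, contour systems ending at the averaged point / staircase contours) in the two
EXTREME rows `q = p = ∞` (`B4Lemma22SupStair`, `B4Lemma22CrossSup.lemma22_17_sup_box`, `B4Lemma22L1Stair`) and
`q = p = 1` (`B4Lemma22DualL1`, `B4Lemma22L1Stair`).  This file proves the whole DIAGONAL `q = p ∈ [1,∞)` at once,
with ONE constant independent of `p`, for all three members and both derivative conventions
(`D^η_{A₀,μ}` / `D^η_{Ã,μ}`).  The print obtains the interior of the diagonal for the zero-field propagator from the
two extreme rows by the Riesz–Thorin theorem and then runs the perturbation series (2.31)–(2.33) («proved in the same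
way»); Mathlib has no Riesz–Thorin theorem, so the interpolation step is REPLACED by the elementary SCHUR TEST (a
kernel with row sums AND column sums `≤ B` is bounded by `B` on every `ℓ^p`, proved here from the weighted Hölder
inequality `Real.inner_le_weight_mul_Lp_of_nonneg`), applied to the zero-field kernels whose row sums
(`B4Thm110ZeroBox.lemma22_zero_box_rowSum`, `B4Thm110ZeroBoxDeriv.lemma22_zero_box_deriv_rowSum`) and column sums
(`B4Thm110ZeroBox.lemma22_zero_box_colSum`, `B4Lemma22ZeroBoxDerivDual.lemma22_zero_box_deriv_colSum`) the tree
already bounds; the bootstrap (2.31)–(2.33) is then run directly in `‖·‖_p` (the abstract engine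
`B4Lemma22Reduce231.bootstrap/deriv_convert` accepts any nonnegative subadditive functional), and the third member
is obtained from the second by `Gᵀ = G` and `L^p`–`L^{p'}` duality (Hölder, `Real.inner_le_Lp_mul_Lq`; at `p = 1`
the `L¹`–`L^∞` duality of `B4Lemma22DualL1` with the sup row).  Contents:
* §1 the scalar functional `lpS p g = (Σ|g|^p)^{1/p}`: Minkowski (`Real.Lp_add_le`), homogeneity, shift
  reindexing, the SCHUR TEST `lpS_schur`, composite kernels;
* §2 the mixed norm `lpM p Φ = (Σ_x|φ(x)|^p)^{1/p}` (the `‖·‖_q` of (2.17) at `q = p`, counting measure): Minkowski,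
  `‖rΦ‖_p = |r|‖Φ‖_p`, the Schur test `lpM_le_of_site` / `lpM_kron_le`, gauge invariance `lpM_gauge(_transpose)`,
  the duality `lpM_transpose_le` (`1 < p`, dual witness `|ψ|^{p−2}ψ`), `lpM_one : ‖·‖_1 = l1N`, and
  `lpM_transpose_le_of_rows` (third member from the second on all of `[1,∞)`);
* §3 the pieces of `V_k` in `‖·‖_p` on the fine box from the SITEWISE bounds of `B4Lemma22L1Stair`
  (`bondSum_site`, `quad_site_pt`, `B4Lemma22CrossSup.cross_zeroth_le`) by Minkowski over the `d+1` directions and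
  the backward shift: `‖Cᵀu‖_p ≤ ℓθΣ_μ‖D_μu‖_p` (`crossT_lp`), `‖Cu‖_p ≤ ℓθΣ_μ‖D_μu‖_p + (d+1)ℓθ'‖u‖_p`
  (`cross_lp`), `‖F₁^*F₁u‖_p ≤ (d+1)ℓ²θ²‖u‖_p` (`quad_lp`);
* §4 the `a`-terms: `F₂^*Q₀`, `Q₀^*F₂`, `F₂^*F₂` are fine-lattice kernels `Σ_y w(y,x)w(y,x')·(ℓτ)^j` with EQUAL row
  and column sums `n^{d+1}(ℓτ)^j` (`B4Lower18Regular.sum_blkWt_row/col` composed), hence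
  `‖a_kn^{-(d+1)}(…)u‖_p ≤ a_kℓτ(2+ℓτ)‖u‖_p` for every `p` (`aterm_lpM_le'`);
* §5 `firstOrderSmall_pertV_lp`: `V_k` is first-order small in `‖·‖_p` relative to `(D^η_{A₀,μ})_μ` with the
  `p`-INDEPENDENT constant of the sup row;
* §6 the zero-field and constant-field `‖·‖_p` hypotheses `zero_box_lp`, `const_box_lp` (gauge step of p. 581 via
  `B4Lemma22ReduceZero.hyps_conj`), and the `‖·‖_p` conversion `covDeriv_sub_lpM_le` (`‖(D_Ã − D_{A₀})u‖_p ≤ ℓθ‖u‖_p`);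
* §7 `lemma22_17_lp_box`: on a fine box with an arbitrary contour system ending at the averaged point, under the
  SAME hypotheses as `B4Lemma22CrossSup.lemma22_17_sup_box` / `B4Lemma22L1Stair.lemma22_17_l1_box`, for EVERY
  `p ≥ 1`: `‖Gf‖_p + Σ_μ‖D^η_{A₀,μ}Gf‖_p ≤ 2(d+2)c‖f‖_p`, `‖D^η_{Ã,μ}Gf‖_p ≤ (1+ℓθ)2(d+2)c‖f‖_p`,
  `‖G(D^η_{A₀,μ})ᵀf‖_p ≤ 2(d+2)c‖f‖_p`, `‖G(D^η_{Ã,μ})ᵀf‖_p ≤ (1+ℓθ)2(d+2)c‖f‖_p`;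
* §8 `lemma22_17_lp_stair`: the staircase specialisation with invertibility (`green_box_l2_bound`), `hend`
  (`stairContour_end`) and `τ = (d+1)θ` (`stair_lsum_le`) discharged, exactly as in `B4Lemma22SupStair` /
  `B4Lemma22L1Stair`.
With the row `q = p = ∞` of `B4Lemma22SupStair.lemma22_17_sup_stair` / `B4Lemma22L1Stair.lemma22_17_l1_deriv_stair`
this gives ALL THREE members `n ≤ 1` of (2.17) on the WHOLE DIAGONAL `q = p ∈ [1,∞]` for `G_k(□,Ã)` on boxes with
staircase contours, every operator-side hypothesis discharged inside the lineage.

## Honest scope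

(a) Boxes `Π[0,(ℓ+1)^kM_μ)` and (in §8) the lineage's staircase contours only; no torus, no general region, no link
`Ã ↔` the torus configuration of pp. 575–576.  (b) The hypotheses are the (2.23)-TYPE bounds with FREE parameters
`θ` (bond size `|κA'_b| ≤ θ/n`), `θ'` (discrete derivative `|κ(A'(b') − A'(b))| ≤ θ'/n²`), `τ` (contour sums; `(d+1)θ`
in §8) and the boundary condition "`A' = 0` on the `μ`-bonds touching the `μ`-faces", plus explicit smallness
inequalities («for e sufficiently small»; in [B4] `θ, θ' = O(e^βc)`): their provenance from (1.7) for the fields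
`Ã_j` of (2.8)–(2.10) is NOT certified here.  (c) Only the DIAGONAL `q = p` (real `p ∈ [1,∞)`; `p = ∞` is the sup
row of the sibling files) and only the members `n ≤ 1`; the OFF-DIAGONAL part of the printed range
`1/p − 1/p₁ ≤ 1/q < 1/p` (which needs the `L¹ → L^{p'₁}` bound (2.37) and genuine Riesz–Thorin interpolation) and
(2.16) are not touched.  (d) DIVERGENCE from the print: the Schur test / weighted Hölder and an explicit `L^p` dual
witness replace the Riesz–Thorin theorem («For Riesz-Thorin Theorem see Ref. [6].»); same conclusions on the
diagonal, same constants as the extreme rows.  (e) Constants explicit, not optimised.  (f) Value = kernel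
certificate of printed inference steps, NOT summit progress.  No manuscript step is used as a hypothesis of a
theorem claiming a printed conclusion; 0 cited facts; every theorem is proved from the lineage's definitions and
Mathlib's mean inequalities.
-/

namespace Literature.MathematicalPhysics.QuantumFieldTheory.Balaban1983to89.B4Lemma22LpStair

open Finset Matrix
open scoped Kronecker
open Literature.MathematicalPhysics.QuantumFieldTheory.Balaban1983to89.B4GaugeCovariance
open Literature.MathematicalPhysics.QuantumFieldTheory.Balaban1983to89.B4Lower18Regular (e1 kmul kmul_apply pertE
  pertT crossOp quadOp pertF vOp lsum sum_blkWt_row sum_blkWt_col baseEmb stairContour stairContour_end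
  green_box_l2_bound)
open Literature.MathematicalPhysics.QuantumFieldTheory.Balaban1983to89.B4Lemma21Region (siteNorm covDeriv)
open Literature.MathematicalPhysics.QuantumFieldTheory.Balaban1983to89.B4Reflection242 (nbrs boxDom nbrs_comm)
open Literature.MathematicalPhysics.QuantumFieldTheory.Balaban1983to89.B4BoxCov237 (boxOpR_det_isUnit)
open Literature.MathematicalPhysics.QuantumFieldTheory.Balaban1983to89.B4Thm110ZeroBox (lemma22_zero_box_rowSum
  lemma22_zero_box_colSum)
open Literature.MathematicalPhysics.QuantumFieldTheory.Balaban1983to89.B4Thm110ZeroBoxDeriv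
  (lemma22_zero_box_deriv_rowSum)
open Literature.MathematicalPhysics.QuantumFieldTheory.Balaban1983to89.B4Lemma22ZeroBoxDerivDual
  (fwd lemma22_zero_box_deriv_colSum)
open Literature.MathematicalPhysics.QuantumFieldTheory.Balaban1983to89.B4Lemma22Reduce231
open Literature.MathematicalPhysics.QuantumFieldTheory.Balaban1983to89.B4Lemma22ReduceZero
open Literature.MathematicalPhysics.QuantumFieldTheory.Balaban1983to89.B4Lemma22ReduceDeriv (siteNorm_flow_sub_one_le
  siteNorm_flow add_e1_mem_nbrs covDeriv_sub_fld_of_mem covDeriv_sub_fld_of_not_mem)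
open Literature.MathematicalPhysics.QuantumFieldTheory.Balaban1983to89.B4Lemma22PertVSup (siteNorm_neg
  fld_crossOp_transpose_mulVec fld_quadOp_mulVec pertE_mulVec_le pertE_transpose_mulVec_le constBond_antisymm
  boxWt_nonneg bond_fwd bond_bwd card_nbrs_filter_le blkWt_nonneg contourTrans_fieldLink fld_avgOp_transpose_mulVec)
open Literature.MathematicalPhysics.QuantumFieldTheory.Balaban1983to89.B4Lemma22CrossSup (cross_site_eq sum_box_nbrs
  cross_zeroth_le lemma22_17_sup_box)
open Literature.MathematicalPhysics.QuantumFieldTheory.Balaban1983to89.B4Lemma22SupStair (stair_lsum_le)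
open Literature.MathematicalPhysics.QuantumFieldTheory.Balaban1983to89.B4Lemma22DualL1 (b4Green_transpose
  dotProduct_eq_sum_fld dot_le_siteNorm_mul l1N_transpose_le)
open Literature.MathematicalPhysics.QuantumFieldTheory.Balaban1983to89.B4Lemma22L1Stair

noncomputable section

variable {ι : Type} [Fintype ι] [DecidableEq ι]

/-! ## §1 The scalar `ℓ^p` functional, Minkowski, and the SCHUR TEST by weighted Hölder -/

section Scalar

variable {X : Type*} [Fintype X]

/-- the scalar `ℓ^p` functional `(Σ_x |g(x)|^p)^{1/p}` of a site function (real `p`; used for `p ≥ 1`).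
[folklore] -/
def lpS (p : ℝ) (g : X → ℝ) : ℝ := (∑ x, |g x| ^ p) ^ p⁻¹

/-- `0 ≤ (Σ|g|^p)^{1/p}`. [folklore] -/
theorem lpS_nonneg (p : ℝ) (g : X → ℝ) : 0 ≤ lpS p g :=
  Real.rpow_nonneg (sum_nonneg fun _ _ => Real.rpow_nonneg (abs_nonneg _) _) _

/-- monotonicity in the pointwise order of absolute values. [folklore] -/
theorem lpS_mono {p : ℝ} (hp : 0 < p) {g h : X → ℝ} (hgh : ∀ x, |g x| ≤ |h x|) : lpS p g ≤ lpS p h :=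
  Real.rpow_le_rpow (sum_nonneg fun _ _ => Real.rpow_nonneg (abs_nonneg _) _)
    (sum_le_sum fun x _ => Real.rpow_le_rpow (abs_nonneg _) (hgh x) hp.le) (inv_nonneg.2 hp.le)

/-- monotonicity for a nonnegative minorant. [folklore] -/
theorem lpS_mono' {p : ℝ} (hp : 0 < p) {g h : X → ℝ} (hg : ∀ x, 0 ≤ g x) (hgh : ∀ x, g x ≤ h x) :
    lpS p g ≤ lpS p h :=
  lpS_mono hp fun x => by
    rw [abs_of_nonneg (hg x)]
    exact (hgh x).trans (le_abs_self _)

/-- **MINKOWSKI** (Mathlib `Real.Lp_add_le`). [folklore] -/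
theorem lpS_add_le {p : ℝ} (hp : 1 ≤ p) (g h : X → ℝ) : lpS p (fun x => g x + h x) ≤ lpS p g + lpS p h := by
  have key := Real.Lp_add_le (univ : Finset X) g h hp
  simp only [one_div] at key
  exact key

/-- `lpS p 0 = 0` (`p ≠ 0`). [folklore] -/
theorem lpS_zero {p : ℝ} (hp : p ≠ 0) : lpS p (fun _ : X => (0 : ℝ)) = 0 := by
  show (∑ _x : X, |(0 : ℝ)| ^ p) ^ p⁻¹ = 0
  rw [abs_zero, Real.zero_rpow hp, sum_const_zero, Real.zero_rpow (inv_ne_zero hp)]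

/-- Minkowski for finite sums. [folklore] -/
theorem lpS_sum_le {p : ℝ} (hp : 1 ≤ p) {α : Type*} (s : Finset α) (g : α → X → ℝ) :
    lpS p (fun x => ∑ a ∈ s, g a x) ≤ ∑ a ∈ s, lpS p (g a) := by
  classical
  induction s using Finset.induction_on with
  | empty =>
      simp only [sum_empty]
      rw [lpS_zero (by linarith)]
  | insert a s ha ih =>
      simp only [sum_insert ha]
      exact (lpS_add_le hp _ _).trans (add_le_add le_rfl ih)

/-- homogeneity for a nonnegative constant (`p ≠ 0`). [folklore] -/
theorem lpS_const_mul {p : ℝ} (hp : p ≠ 0) {c : ℝ} (hc : 0 ≤ c) (g : X → ℝ) :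
    lpS p (fun x => c * g x) = c * lpS p g := by
  unfold lpS
  have h1 : ∀ x, |c * g x| ^ p = c ^ p * |g x| ^ p := fun x => by
    rw [abs_mul, abs_of_nonneg hc, Real.mul_rpow hc (abs_nonneg _)]
  simp_rw [h1]
  rw [← mul_sum, Real.mul_rpow (Real.rpow_nonneg hc _) (sum_nonneg fun _ _ => Real.rpow_nonneg (abs_nonneg _) _),
    Real.rpow_rpow_inv hc hp]

/-- **SHIFT REINDEXING IN `ℓ^p`**: for an injective lattice map `s` and `g` on a finite region,
`‖z ↦ [s(z) ∈ R]·g(s(z))‖_p ≤ ‖g‖_p`. [folklore] -/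
theorem lpS_shift_le {d : ℕ} {p : ℝ} (hp : 0 < p) {R : Finset (Fin (d + 1) → ℤ)}
    {s : (Fin (d + 1) → ℤ) → (Fin (d + 1) → ℤ)} (hs : Function.Injective s) (g : ↥R → ℝ) :
    lpS p (fun z : ↥R => if h : s z.1 ∈ R then g ⟨s z.1, h⟩ else 0) ≤ lpS p g := by
  unfold lpS
  refine Real.rpow_le_rpow (sum_nonneg fun _ _ => Real.rpow_nonneg (abs_nonneg _) _) ?_ (inv_nonneg.2 hp.le)
  have h1 : ∀ z : ↥R, |(if h : s z.1 ∈ R then g ⟨s z.1, h⟩ else 0)| ^ p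
      = (if h : s z.1 ∈ R then |g ⟨s z.1, h⟩| ^ p else 0) := by
    intro z
    split_ifs with h
    · rfl
    · rw [abs_zero, Real.zero_rpow hp.ne']
  simp_rw [h1]
  exact sum_dite_shift_le hs (fun y => |g y| ^ p) fun y => Real.rpow_nonneg (abs_nonneg _) _

/-- **THE SCHUR TEST IN `ℓ^p`** (scalar form): if `0 ≤ ψ(y) ≤ Σ_x k(y,x)φ(x)` with `k, φ ≥ 0`, ROW sums
`Σ_x k(y,x) ≤ B` and COLUMN sums `Σ_y k(y,x) ≤ B`, then `‖ψ‖_p ≤ B‖φ‖_p` for every `p ≥ 1` — by the weighted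
Hölder inequality `Σ_x kφ ≤ (Σ_x k)^{1−1/p}(Σ_x kφ^p)^{1/p}` (Mathlib `Real.inner_le_weight_mul_Lp_of_nonneg`) and
the exchange of the two sums.  (In [B4] the interior of the diagonal is obtained from the two extreme rows by the
Riesz–Thorin theorem; the Schur test is the elementary substitute with the same constants.) [folklore] -/
theorem lpS_schur {Y : Type*} [Fintype Y] {p : ℝ} (hp : 1 ≤ p) {ψ : Y → ℝ} {φ : X → ℝ} (hψ : ∀ y, 0 ≤ ψ y)
    (hφ : ∀ x, 0 ≤ φ x) {k : Y → X → ℝ} (hk : ∀ y x, 0 ≤ k y x) (h : ∀ y, ψ y ≤ ∑ x, k y x * φ x) {B : ℝ}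
    (hB : 0 ≤ B) (hR : ∀ y, ∑ x, k y x ≤ B) (hC : ∀ x, ∑ y, k y x ≤ B) : lpS p ψ ≤ B * lpS p φ := by
  have hp0 : 0 < p := by linarith
  -- Step 1: `ψ(y)^p ≤ B^{p−1} Σ_x k(y,x) φ(x)^p`
  have step1 : ∀ y, ψ y ^ p ≤ B ^ (p - 1) * ∑ x, k y x * φ x ^ p := by
    intro y
    have hw := Real.inner_le_weight_mul_Lp_of_nonneg (univ : Finset X) hp (k y) φ (hk y) hφ
    have hK0 : 0 ≤ ∑ x, k y x := sum_nonneg fun x _ => hk y x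
    have hS0 : 0 ≤ ∑ x, k y x * φ x ^ p := sum_nonneg fun x _ => mul_nonneg (hk y x) (Real.rpow_nonneg (hφ x) _)
    have h1 : ψ y ≤ (∑ x, k y x) ^ (1 - p⁻¹) * (∑ x, k y x * φ x ^ p) ^ p⁻¹ := (h y).trans hw
    have h2 := Real.rpow_le_rpow (hψ y) h1 hp0.le
    refine h2.trans ?_
    rw [Real.mul_rpow (Real.rpow_nonneg hK0 _) (Real.rpow_nonneg hS0 _), ← Real.rpow_mul hK0,
      Real.rpow_inv_rpow hS0 hp0.ne']
    have he : (1 - p⁻¹) * p = p - 1 := by field_simp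
    rw [he]
    exact mul_le_mul_of_nonneg_right (Real.rpow_le_rpow hK0 (hR y) (by linarith)) hS0
  -- Step 2: sum over `y`, exchange, column sums
  have step2 : ∑ y, ψ y ^ p ≤ B ^ p * ∑ x, φ x ^ p := by
    calc ∑ y, ψ y ^ p ≤ ∑ y, B ^ (p - 1) * ∑ x, k y x * φ x ^ p := sum_le_sum fun y _ => step1 y
      _ = B ^ (p - 1) * ∑ x, (∑ y, k y x) * φ x ^ p := by
          rw [← mul_sum, sum_comm]
          refine congrArg _ (sum_congr rfl fun x _ => ?_)
          rw [sum_mul]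
      _ ≤ B ^ (p - 1) * ∑ x, B * φ x ^ p := by
          refine mul_le_mul_of_nonneg_left (sum_le_sum fun x _ => ?_) (Real.rpow_nonneg hB _)
          exact mul_le_mul_of_nonneg_right (hC x) (Real.rpow_nonneg (hφ x) _)
      _ = B ^ p * ∑ x, φ x ^ p := by
          rw [← mul_sum, ← mul_assoc]
          congr 1
          have : B ^ p = B ^ ((p - 1) + 1) := by rw [sub_add_cancel]
          rw [this, Real.rpow_add' hB (by rw [sub_add_cancel]; exact hp0.ne'), Real.rpow_one]
  -- Step 3: `p`-th roots
  unfold lpS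
  have hψ' : ∀ y, |ψ y| ^ p = ψ y ^ p := fun y => by rw [abs_of_nonneg (hψ y)]
  have hφ' : ∀ x, |φ x| ^ p = φ x ^ p := fun x => by rw [abs_of_nonneg (hφ x)]
  simp_rw [hψ', hφ']
  have hΦ0 : 0 ≤ ∑ x, φ x ^ p := sum_nonneg fun x _ => Real.rpow_nonneg (hφ x) _
  calc (∑ y, ψ y ^ p) ^ p⁻¹ ≤ (B ^ p * ∑ x, φ x ^ p) ^ p⁻¹ :=
        Real.rpow_le_rpow (sum_nonneg fun y _ => Real.rpow_nonneg (hψ y) _) step2 (inv_nonneg.2 hp0.le)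
    _ = B * (∑ x, φ x ^ p) ^ p⁻¹ := by
        rw [Real.mul_rpow (Real.rpow_nonneg hB _) hΦ0, Real.rpow_rpow_inv hB hp0.ne']

/-- row and column sums of a COMPOSITE kernel `K(x,x') = Σ_y k₁(x,y)k₂(y,x')`. [folklore] -/
theorem comp_row_le {Y Z : Type*} [Fintype Y] [Fintype Z] {k₁ : Z → Y → ℝ} {k₂ : Y → X → ℝ}
    (hk₁ : ∀ z y, 0 ≤ k₁ z y) {R₁ R₂ : ℝ} (hR₂ : 0 ≤ R₂) (h₁ : ∀ z, ∑ y, k₁ z y ≤ R₁)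
    (h₂ : ∀ y, ∑ x, k₂ y x ≤ R₂) (z : Z) : ∑ x, (∑ y, k₁ z y * k₂ y x) ≤ R₁ * R₂ := by
  rw [sum_comm]
  calc ∑ y, ∑ x, k₁ z y * k₂ y x = ∑ y, k₁ z y * ∑ x, k₂ y x :=
        sum_congr rfl fun y _ => (mul_sum _ _ _).symm
    _ ≤ ∑ y, k₁ z y * R₂ := sum_le_sum fun y _ => mul_le_mul_of_nonneg_left (h₂ y) (hk₁ z y)
    _ = (∑ y, k₁ z y) * R₂ := (sum_mul _ _ _).symm
    _ ≤ R₁ * R₂ := mul_le_mul_of_nonneg_right (h₁ z) hR₂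

omit [Fintype X] in
/-- column sums of a composite kernel `Σ_y k₁(z,y)k₂(y,x)`: `≤ C₁C₂` if the column sums of `k₁`, `k₂` are `≤ C₁`,
`≤ C₂`. [folklore] -/
theorem comp_col_le {Y Z : Type*} [Fintype Y] [Fintype Z] {k₁ : Z → Y → ℝ} {k₂ : Y → X → ℝ}
    (hk₂ : ∀ y x, 0 ≤ k₂ y x) {C₁ C₂ : ℝ} (hC₁ : 0 ≤ C₁) (h₁ : ∀ y, ∑ z, k₁ z y ≤ C₁)
    (h₂ : ∀ x, ∑ y, k₂ y x ≤ C₂) (x : X) : ∑ z, (∑ y, k₁ z y * k₂ y x) ≤ C₁ * C₂ := by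
  rw [sum_comm]
  calc ∑ y, ∑ z, k₁ z y * k₂ y x = ∑ y, (∑ z, k₁ z y) * k₂ y x :=
        sum_congr rfl fun y _ => (sum_mul _ _ _).symm
    _ ≤ ∑ y, C₁ * k₂ y x := sum_le_sum fun y _ => mul_le_mul_of_nonneg_right (h₁ y) (hk₂ y x)
    _ = C₁ * ∑ y, k₂ y x := (mul_sum _ _ _).symm
    _ ≤ C₁ * C₂ := mul_le_mul_of_nonneg_left (h₂ x) hC₁

/-- composing two sitewise kernel bounds. [folklore] -/
theorem comp_site_le {Y Z : Type*} [Fintype Y] [Fintype Z] {ψ : Z → ℝ} {χ : Y → ℝ} {φ : X → ℝ}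
    {k₁ : Z → Y → ℝ} {k₂ : Y → X → ℝ} (hk₁ : ∀ z y, 0 ≤ k₁ z y) (h₁ : ∀ z, ψ z ≤ ∑ y, k₁ z y * χ y)
    (h₂ : ∀ y, χ y ≤ ∑ x, k₂ y x * φ x) (z : Z) : ψ z ≤ ∑ x, (∑ y, k₁ z y * k₂ y x) * φ x := by
  refine (h₁ z).trans ?_
  calc ∑ y, k₁ z y * χ y ≤ ∑ y, k₁ z y * ∑ x, k₂ y x * φ x :=
        sum_le_sum fun y _ => mul_le_mul_of_nonneg_left (h₂ y) (hk₁ z y)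
    _ = ∑ x, (∑ y, k₁ z y * k₂ y x) * φ x := by
        simp_rw [mul_sum, sum_mul, mul_assoc]
        rw [sum_comm]

end Scalar

/-! ## §2 The mixed `ℓ^p` norm `‖Φ‖_p = (Σ_x |φ(x)|^p)^{1/p}` of an `N`-component field -/

section Mixed

variable {X : Type*} [Fintype X]

/-- **THE MIXED `ℓ^p` NORM** of an `N`-component lattice field: the scalar `ℓ^p` functional of the Euclidean site
norms, `‖Φ‖_p = (Σ_x |φ(x)|^p)^{1/p}` ([B4] (2.17) with the counting measure in place of `η^dΣ_x`; at `q = p` the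
factor `η^{d/p}` cancels between the two sides). [cite: Balaban1983RegularityDecay, Lemma 2.2 (2.17) p. 578] -/
def lpM (p : ℝ) (Φ : X × ι → ℝ) : ℝ := lpS p fun x => siteNorm (fld Φ x)

omit [DecidableEq ι] in
/-- `0 ≤ ‖Φ‖_p`. [folklore] -/
theorem lpM_nonneg (p : ℝ) (Φ : X × ι → ℝ) : 0 ≤ lpM p Φ := lpS_nonneg _ _

omit [DecidableEq ι] in
/-- **MINKOWSKI for the mixed norm.** [folklore] -/
theorem lpM_add_le {p : ℝ} (hp : 1 ≤ p) (Φ Ψ : X × ι → ℝ) : lpM p (Φ + Ψ) ≤ lpM p Φ + lpM p Ψ := by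
  unfold lpM
  refine (lpS_mono' (by linarith) (fun x => siteNorm_nonneg _) fun x => ?_).trans (lpS_add_le hp _ _)
  rw [fld_add]
  exact siteNorm_add_le _ _

omit [DecidableEq ι] in
/-- `‖−Φ‖_p = ‖Φ‖_p`. [folklore] -/
theorem lpM_neg (p : ℝ) (Φ : X × ι → ℝ) : lpM p (-Φ) = lpM p Φ := by
  unfold lpM
  congr 1
  funext x
  exact siteNorm_neg (fld Φ x)

omit [DecidableEq ι] in
/-- `‖r • Φ‖_p = |r|‖Φ‖_p`. [folklore] -/
theorem lpM_smul {p : ℝ} (hp : p ≠ 0) (r : ℝ) (Φ : X × ι → ℝ) : lpM p (r • Φ) = |r| * lpM p Φ := by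
  unfold lpM
  rw [← lpS_const_mul hp (abs_nonneg r)]
  congr 1
  funext x
  have : fld (r • Φ) x = r • fld Φ x := rfl
  rw [this, siteNorm_smul]

omit [DecidableEq ι] in
/-- **THE SCHUR TEST FOR THE MIXED NORM**: a sitewise kernel bound `|ψ(y)| ≤ Σ_x k(y,x)|u(x)|` (`k ≥ 0`) with row
AND column sums `≤ B` gives `‖Ψ‖_p ≤ B‖u‖_p` for every `p ≥ 1`. [folklore] -/
theorem lpM_le_of_site {Y : Type*} [Fintype Y] {p : ℝ} (hp : 1 ≤ p) (Ψ : Y × ι → ℝ) (u : X × ι → ℝ)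
    (k : Y → X → ℝ) (hk : ∀ y x, 0 ≤ k y x) (h : ∀ y, siteNorm (fld Ψ y) ≤ ∑ x, k y x * siteNorm (fld u x))
    {B : ℝ} (hB : 0 ≤ B) (hR : ∀ y, ∑ x, k y x ≤ B) (hC : ∀ x, ∑ y, k y x ≤ B) :
    lpM p Ψ ≤ B * lpM p u :=
  lpS_schur hp (fun _ => siteNorm_nonneg _) (fun _ => siteNorm_nonneg _) hk h hB hR hC

/-- the Schur test for a lifted scalar kernel `S ⊗ 1`. [folklore] -/
theorem lpM_kron_le {Y : Type*} [Fintype Y] {p : ℝ} (hp : 1 ≤ p) {S : Matrix Y X ℝ} {B : ℝ} (hB : 0 ≤ B)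
    (hR : ∀ y, ∑ x, |S y x| ≤ B) (hC : ∀ x, ∑ y, |S y x| ≤ B) (Φ : X × ι → ℝ) :
    lpM p ((S ⊗ₖ (1 : Matrix ι ι ℝ)) *ᵥ Φ) ≤ B * lpM p Φ :=
  lpM_le_of_site hp _ Φ (fun y x => |S y x|) (fun _ _ => abs_nonneg _) (siteNorm_kron_row_le S Φ) hB hR hC

/-- **GAUGE INVARIANCE** `‖𝒢Φ‖_p = ‖Φ‖_p`. [cite: Balaban1983RegularityDecay, p. 581 «by the same argument with the
gauge transformation»] -/
theorem lpM_gauge [DecidableEq X] (p : ℝ) {g : X → Matrix ι ι ℝ} (hg : IsGauge g) (Φ : X × ι → ℝ) :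
    lpM p (blockDiag g *ᵥ Φ) = lpM p Φ := by
  unfold lpM
  congr 1
  funext x
  rw [fld_blockDiag_mulVec, siteNorm_gauge_mulVec hg]

/-- `‖𝒢ᵀΦ‖_p = ‖Φ‖_p`. [folklore] -/
theorem lpM_gauge_transpose [DecidableEq X] (p : ℝ) {g : X → Matrix ι ι ℝ} (hg : IsGauge g) (Φ : X × ι → ℝ) :
    lpM p ((blockDiag g)ᵀ *ᵥ Φ) = lpM p Φ := by
  rw [B4GaugeCovariance.blockDiag_transpose]
  exact lpM_gauge p (isGauge_transpose hg) Φ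

omit [DecidableEq ι] in
/-- **DUALITY FOR THE MIXED `ℓ^p` NORMS** (`1 < p < ∞`, `1/p + 1/q = 1`): `‖TΦ‖_q ≤ B‖Φ‖_q` for all `Φ` gives
`‖Tᵀg‖_p ≤ B‖g‖_p` for all `g` — by the dual witness `Φ(x) = |ψ(x)|^{p−2}ψ(x)`, `Ψ = Tᵀg` (`⟨Ψ,Φ⟩ = Σ|ψ|^p`,
`‖Φ‖_q = (Σ|ψ|^p)^{1/q}`) and Hölder's inequality sitewise and over the sites (Mathlib `Real.inner_le_Lp_mul_Lq`).
(«using the fact that the space L^∞(□) is adjoint to L¹(□)» — here `L^q` adjoint to `L^p`.) [folklore] -/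
theorem lpM_transpose_le {p q : ℝ} (hpq : p.HolderConjugate q) {T : Matrix (X × ι) (X × ι) ℝ} {B : ℝ} (hB : 0 ≤ B)
    (h : ∀ Φ, lpM q (T *ᵥ Φ) ≤ B * lpM q Φ) (g : X × ι → ℝ) : lpM p (Tᵀ *ᵥ g) ≤ B * lpM p g := by
  have hp1 : 1 < p := hpq.lt
  have hp0 : 0 < p := hpq.pos
  have hq0 : 0 < q := hpq.symm.pos
  set Ψ : X × ι → ℝ := Tᵀ *ᵥ g with hΨ
  -- the dual witness
  set Φ : X × ι → ℝ := fun z => siteNorm (fld Ψ z.1) ^ (p - 2) * Ψ z with hΦ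
  have hfldΦ : ∀ x, fld Φ x = (siteNorm (fld Ψ x) ^ (p - 2)) • fld Ψ x := fun x => by
    ext i; simp only [fld_apply, hΦ, Pi.smul_apply, smul_eq_mul]
  have hsΦ : ∀ x, siteNorm (fld Φ x) = siteNorm (fld Ψ x) ^ (p - 1) := by
    intro x
    rw [hfldΦ, siteNorm_smul, abs_of_nonneg (Real.rpow_nonneg (siteNorm_nonneg _) _)]
    by_cases h0 : siteNorm (fld Ψ x) = 0
    · rw [h0, mul_zero, Real.zero_rpow (by linarith)]
    · rw [← Real.rpow_add_one h0, show p - 2 + 1 = p - 1 by ring]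
  set S : ℝ := ∑ x, siteNorm (fld Ψ x) ^ p with hS
  have hS0 : 0 ≤ S := sum_nonneg fun x _ => Real.rpow_nonneg (siteNorm_nonneg _) _
  -- `⟨Ψ,Φ⟩ = S`
  have hdot : Ψ ⬝ᵥ Φ = S := by
    rw [dotProduct_eq_sum_fld]
    refine sum_congr rfl fun x _ => ?_
    rw [hfldΦ, dotProduct_smul, smul_eq_mul]
    have h00 : 0 ≤ fld Ψ x ⬝ᵥ fld Ψ x := Finset.sum_nonneg fun i _ => mul_self_nonneg _
    have hsq : fld Ψ x ⬝ᵥ fld Ψ x = siteNorm (fld Ψ x) ^ (2 : ℝ) := by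
      rw [Real.rpow_two]
      unfold siteNorm
      rw [Real.sq_sqrt h00]
    rw [hsq]
    by_cases h0 : siteNorm (fld Ψ x) = 0
    · rw [h0, Real.zero_rpow two_ne_zero, mul_zero, Real.zero_rpow hp0.ne']
    · rw [← Real.rpow_add (lt_of_le_of_ne (siteNorm_nonneg _) (Ne.symm h0)), show p - 2 + 2 = p by ring]
  -- `‖Φ‖_q = S^{1/q}`
  have hΦq : lpM q Φ = S ^ q⁻¹ := by
    unfold lpM lpS
    congr 1
    refine sum_congr rfl fun x _ => ?_
    rw [abs_of_nonneg (siteNorm_nonneg _), hsΦ, ← Real.rpow_mul (siteNorm_nonneg _), hpq.sub_one_mul_conj]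
  -- `‖Ψ‖_p = S^{1/p}`
  have hΨp : lpM p Ψ = S ^ p⁻¹ := by
    unfold lpM lpS
    congr 1
    exact sum_congr rfl fun x _ => by rw [abs_of_nonneg (siteNorm_nonneg _)]
  -- Hölder: `S = ⟨Tᵀg, Φ⟩ = ⟨g, TΦ⟩ ≤ ‖g‖_p ‖TΦ‖_q ≤ ‖g‖_p · B · S^{1/q}`
  have hH : S ≤ lpM p g * (B * S ^ q⁻¹) := by
    have e1 : S = g ⬝ᵥ (T *ᵥ Φ) := by
      rw [← hdot, hΨ, Matrix.mulVec_transpose, Matrix.dotProduct_mulVec]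
    calc S = ∑ x, fld g x ⬝ᵥ fld (T *ᵥ Φ) x := by rw [e1, dotProduct_eq_sum_fld]
      _ ≤ ∑ x, siteNorm (fld g x) * siteNorm (fld (T *ᵥ Φ) x) :=
          sum_le_sum fun x _ => dot_le_siteNorm_mul _ _
      _ ≤ (∑ x, |siteNorm (fld g x)| ^ p) ^ (1 / p) * (∑ x, |siteNorm (fld (T *ᵥ Φ) x)| ^ q) ^ (1 / q) :=
          Real.inner_le_Lp_mul_Lq univ _ _ hpq
      _ = lpM p g * lpM q (T *ᵥ Φ) := by rw [one_div, one_div]; rfl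
      _ ≤ lpM p g * (B * S ^ q⁻¹) := by
          rw [← hΦq]
          exact mul_le_mul_of_nonneg_left (h Φ) (lpM_nonneg _ _)
  -- conclude: `S^{1/p} ≤ B‖g‖_p`
  rw [hΨp]
  by_cases hS1 : S = 0
  · rw [hS1, Real.zero_rpow (inv_ne_zero hp0.ne')]
    exact mul_nonneg hB (lpM_nonneg _ _)
  have hSpos : 0 < S := lt_of_le_of_ne hS0 (Ne.symm hS1)
  have hSq : 0 < S ^ q⁻¹ := Real.rpow_pos_of_pos hSpos _
  have key : S * (S ^ q⁻¹)⁻¹ ≤ B * lpM p g := by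
    rw [mul_inv_le_iff₀ hSq]
    calc S ≤ lpM p g * (B * S ^ q⁻¹) := hH
      _ = B * lpM p g * S ^ q⁻¹ := by ring
  have e2 : S * (S ^ q⁻¹)⁻¹ = S ^ p⁻¹ := by
    have hp' : p⁻¹ = 1 + -q⁻¹ := by linarith [hpq.inv_add_inv_eq_one]
    rw [← Real.rpow_neg hS0, hp', Real.rpow_add hSpos, Real.rpow_one]
  rw [← e2]
  exact key

omit [DecidableEq ι] in
/-- `‖Φ‖_1` is the mixed `ℓ¹` norm `B4Lemma22Reduce231.l1N`. [folklore] -/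
theorem lpM_one (Φ : X × ι → ℝ) : lpM 1 Φ = l1N Φ := by
  unfold lpM lpS l1N
  rw [inv_one, Real.rpow_one]
  exact sum_congr rfl fun x _ => by rw [Real.rpow_one, abs_of_nonneg (siteNorm_nonneg _)]

omit [DecidableEq ι] in
/-- **THE THIRD MEMBER FROM THE SECOND, ON THE WHOLE DIAGONAL**: if `‖TΦ‖_q ≤ B‖Φ‖_q` for every `q ≥ 1` and
`‖TΦ‖_∞ ≤ B‖Φ‖_∞`, then `‖Tᵀg‖_p ≤ B‖g‖_p` for every `p ≥ 1` — for `p > 1` by `lpM_transpose_le` at the conjugate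
exponent, for `p = 1` by the `L^∞`/`L¹` duality `B4Lemma22DualL1.l1N_transpose_le` («For q = p = 1 we get it by
duality argument, i.e. using the fact that the space L^∞(□) is adjoint to L¹(□).»). [folklore] -/
theorem lpM_transpose_le_of_rows {T : Matrix (X × ι) (X × ι) ℝ} {B : ℝ} (hB : 0 ≤ B)
    (hrow : ∀ q : ℝ, 1 ≤ q → ∀ Φ, lpM q (T *ᵥ Φ) ≤ B * lpM q Φ) (hsup : ∀ Φ, supN (T *ᵥ Φ) ≤ B * supN Φ)
    {p : ℝ} (hp : 1 ≤ p) (g : X × ι → ℝ) : lpM p (Tᵀ *ᵥ g) ≤ B * lpM p g := by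
  by_cases hp1 : 1 < p
  · exact lpM_transpose_le (Real.HolderConjugate.conjExponent hp1) hB
      (hrow _ (Real.HolderConjugate.conjExponent hp1).symm.lt.le) g
  · have h1 : p = 1 := le_antisymm (not_lt.1 hp1) hp
    subst h1
    rw [lpM_one, lpM_one]
    exact l1N_transpose_le hB hsup g

end Mixed

/-! ## §3 The pieces of `V_k` in `‖·‖_p` on the fine box `Π_μ[0,nN_μ)` -/

section Box

variable {d : ℕ}

omit [DecidableEq ι] in
/-- `‖z ↦ Σ_μ(|Φ_μ(z)| + [z−e_μ ∈ □]|Φ_μ(z−e_μ)|)‖_p ≤ 2Σ_μ‖Φ_μ‖_p` (Minkowski + shift reindexing). [folklore] -/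
theorem lpS_dirs_le {R : Finset (Fin (d + 1) → ℤ)} {p : ℝ} (hp : 1 ≤ p) (Φ : Fin (d + 1) → ↥R × ι → ℝ) :
    lpS p (fun z : ↥R => ∑ μ, (siteNorm (fld (Φ μ) z)
        + (if h : z.1 - e1 μ ∈ R then siteNorm (fld (Φ μ) ⟨z.1 - e1 μ, h⟩) else 0)))
      ≤ 2 * ∑ μ, lpM p (Φ μ) := by
  have hp0 : 0 < p := by linarith
  refine (lpS_sum_le hp univ (fun μ (z : ↥R) => siteNorm (fld (Φ μ) z)
    + (if h : z.1 - e1 μ ∈ R then siteNorm (fld (Φ μ) ⟨z.1 - e1 μ, h⟩) else 0))).trans ?_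
  rw [mul_sum]
  refine sum_le_sum fun μ _ => ?_
  refine (lpS_add_le hp (fun z : ↥R => siteNorm (fld (Φ μ) z))
    (fun z : ↥R => if h : z.1 - e1 μ ∈ R then siteNorm (fld (Φ μ) ⟨z.1 - e1 μ, h⟩) else 0)).trans ?_
  rw [two_mul]
  exact add_le_add (le_of_eq rfl)
    (lpS_shift_le hp0 (s := fun w => w - e1 μ) (sub_left_injective) fun y => siteNorm (fld (Φ μ) y))

omit [DecidableEq ι] in
/-- a sitewise bound by the direction sum passes to `‖·‖_p`. [folklore] -/
theorem lpS_le_of_dirs {R : Finset (Fin (d + 1) → ℤ)} {p : ℝ} (hp : 1 ≤ p) {c : ℝ} (hc : 0 ≤ c)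
    (Φ : Fin (d + 1) → ↥R × ι → ℝ) {ψ : ↥R → ℝ} (hψ0 : ∀ z, 0 ≤ ψ z)
    (hψ : ∀ z, ψ z ≤ c * ∑ μ, (siteNorm (fld (Φ μ) z)
        + (if h : z.1 - e1 μ ∈ R then siteNorm (fld (Φ μ) ⟨z.1 - e1 μ, h⟩) else 0))) :
    lpS p ψ ≤ c * (2 * ∑ μ, lpM p (Φ μ)) := by
  have hp0 : 0 < p := by linarith
  calc lpS p ψ ≤ lpS p (fun z : ↥R => c * ∑ μ, (siteNorm (fld (Φ μ) z)
        + (if h : z.1 - e1 μ ∈ R then siteNorm (fld (Φ μ) ⟨z.1 - e1 μ, h⟩) else 0))) := lpS_mono' hp0 hψ0 hψ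
    _ = c * lpS p (fun z : ↥R => ∑ μ, (siteNorm (fld (Φ μ) z)
        + (if h : z.1 - e1 μ ∈ R then siteNorm (fld (Φ μ) ⟨z.1 - e1 μ, h⟩) else 0))) :=
        lpS_const_mul hp0.ne' hc _
    _ ≤ c * (2 * ∑ μ, lpM p (Φ μ)) := mul_le_mul_of_nonneg_left (lpS_dirs_le hp Φ) hc

omit [DecidableEq ι] in
/-- the same with an extra zeroth-order term. [folklore] -/
theorem lpS_le_of_dirs_add {R : Finset (Fin (d + 1) → ℤ)} {p : ℝ} (hp : 1 ≤ p) {c c' : ℝ} (hc : 0 ≤ c)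
    (hc' : 0 ≤ c') (Φ : Fin (d + 1) → ↥R × ι → ℝ) (u : ↥R × ι → ℝ) {ψ : ↥R → ℝ} (hψ0 : ∀ z, 0 ≤ ψ z)
    (hψ : ∀ z, ψ z ≤ c * ∑ μ, (siteNorm (fld (Φ μ) z)
        + (if h : z.1 - e1 μ ∈ R then siteNorm (fld (Φ μ) ⟨z.1 - e1 μ, h⟩) else 0))
        + c' * siteNorm (fld u z)) :
    lpS p ψ ≤ c * (2 * ∑ μ, lpM p (Φ μ)) + c' * lpM p u := by
  have hp0 : 0 < p := by linarith
  have hA0 : ∀ z : ↥R, 0 ≤ c * ∑ μ, (siteNorm (fld (Φ μ) z)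
      + (if h : z.1 - e1 μ ∈ R then siteNorm (fld (Φ μ) ⟨z.1 - e1 μ, h⟩) else 0)) := fun z =>
    mul_nonneg hc (sum_nonneg fun μ _ => add_nonneg (siteNorm_nonneg _)
      (by split_ifs <;> first | exact siteNorm_nonneg _ | exact le_rfl))
  calc lpS p ψ ≤ lpS p (fun z : ↥R => c * ∑ μ, (siteNorm (fld (Φ μ) z)
        + (if h : z.1 - e1 μ ∈ R then siteNorm (fld (Φ μ) ⟨z.1 - e1 μ, h⟩) else 0))
        + c' * siteNorm (fld u z)) := lpS_mono' hp0 hψ0 hψ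
    _ ≤ lpS p (fun z : ↥R => c * ∑ μ, (siteNorm (fld (Φ μ) z)
        + (if h : z.1 - e1 μ ∈ R then siteNorm (fld (Φ μ) ⟨z.1 - e1 μ, h⟩) else 0)))
        + lpS p (fun z : ↥R => c' * siteNorm (fld u z)) := lpS_add_le hp _ _
    _ ≤ c * (2 * ∑ μ, lpM p (Φ μ)) + c' * lpM p u := by
        refine add_le_add (lpS_le_of_dirs hp hc Φ hA0 fun z => le_rfl) (le_of_eq ?_)
        exact lpS_const_mul hp0.ne' hc' _

omit [DecidableEq ι] in
/-- a sitewise zeroth-order bound passes to `‖·‖_p`. [folklore] -/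
theorem lpM_le_of_pt {Y : Type*} [Fintype Y] {p : ℝ} (hp : 1 ≤ p) {C : ℝ} (hC : 0 ≤ C) {Ψ u : Y × ι → ℝ}
    (h : ∀ z, siteNorm (fld Ψ z) ≤ C * siteNorm (fld u z)) : lpM p Ψ ≤ C * lpM p u := by
  have hp0 : 0 < p := by linarith
  unfold lpM
  calc lpS p (fun z => siteNorm (fld Ψ z)) ≤ lpS p (fun z => C * siteNorm (fld u z)) :=
        lpS_mono' hp0 (fun z => siteNorm_nonneg _) h
    _ = C * lpS p (fun z => siteNorm (fld u z)) := lpS_const_mul hp0.ne' hC _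

/-- **`‖Cᵀu‖_p ≤ ℓθ·Σ_μ‖D^η_{A₀,μ}u‖_p`** — the field-side cross term «F_{1,k}(−A')^*D^η_{A₀}» is first-order small
in `‖·‖_p`, under `|κA'_b| ≤ θ/n` on nearest-neighbour bonds (sitewise bound of `B4Lemma22L1Stair.bondSum_site`,
then Minkowski over the directions and the backward shift). [cite: Balaban1983RegularityDecay, p. 581 (2.32)] -/
theorem crossT_lp (F : OrthFlow ι) {ℓ : ℝ} (hℓ : 0 ≤ ℓ)
    (hLip : ∀ t (v : ι → ℝ), ((F.U t - 1) *ᵥ v) ⬝ᵥ ((F.U t - 1) *ᵥ v) ≤ (ℓ * t) ^ 2 * (v ⬝ᵥ v))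
    (κ : ℝ) {n : ℕ} (hn : 1 ≤ n) (N : Fin (d + 1) → ℕ) (A₀ : ↥(boxDom N) → ↥(boxDom N) → ℝ)
    (hanti : ∀ x y, A₀ y x = -A₀ x y) {A' : ↥(boxDom N) → ↥(boxDom N) → ℝ} {θ : ℝ} (hθ : 0 ≤ θ)
    (hA' : ∀ x y, y.1 ∈ nbrs x.1 → |κ * A' x y| ≤ θ / n) {p : ℝ} (hp : 1 ≤ p) (u : ↥(boxDom N) × ι → ℝ) :
    lpM p ((crossOp (boxWt n N) (fieldLink F κ A₀) (pertE (fieldLink F κ A')))ᵀ *ᵥ u)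
      ≤ ℓ * θ * ∑ μ, lpM p (covDeriv n (boxDom N) (fieldLink F κ A₀) μ *ᵥ u) := by
  have hn0 : (0 : ℝ) < n := by exact_mod_cast hn
  have hρ : 0 ≤ ℓ * (θ / n) := mul_nonneg hℓ (div_nonneg hθ hn0.le)
  have hsite : ∀ z, siteNorm (fld ((crossOp (boxWt n N) (fieldLink F κ A₀) (pertE (fieldLink F κ A')))ᵀ *ᵥ u) z)
      ≤ (n : ℝ) / 2 * (ℓ * (θ / n)) * ∑ μ, (siteNorm (fld (covDeriv n (boxDom N) (fieldLink F κ A₀) μ *ᵥ u) z)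
          + (if h : z.1 - e1 μ ∈ boxDom N then
              siteNorm (fld (covDeriv n (boxDom N) (fieldLink F κ A₀) μ *ᵥ u) ⟨z.1 - e1 μ, h⟩) else 0)) := by
    intro z
    rw [fld_crossOp_transpose_mulVec]
    refine bondSum_site F κ hn N A₀ hanti z hρ (fun y hy v => ?_) u
    exact (pertE_transpose_mulVec_le F hℓ hLip κ A' z y v).trans
      (mul_le_mul_of_nonneg_right (mul_le_mul_of_nonneg_left (hA' z y hy) hℓ) (siteNorm_nonneg _))
  unfold lpM
  refine (lpS_le_of_dirs hp (by positivity) (fun μ => covDeriv n (boxDom N) (fieldLink F κ A₀) μ *ᵥ u)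
    (fun z => siteNorm_nonneg _) hsite).trans (le_of_eq ?_)
  unfold lpM
  field_simp

/-- **`‖Cu‖_p ≤ ℓθ·Σ_μ‖D^η_{A₀,μ}u‖_p + (d+1)ℓθ'·‖u‖_p`** — the divergence-form cross term «D^{η*}_{A₀}F_{1,k}(−A')»
in `‖·‖_p`: its covariant-difference part by `bondSum_site`, its divergence part sitewise by
`B4Lemma22CrossSup.cross_zeroth_le`. [cite: Balaban1983RegularityDecay, p. 581 (2.32)] -/
theorem cross_lp (F : OrthFlow ι) {ℓ : ℝ} (hℓ : 0 ≤ ℓ)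
    (hLip : ∀ t (v : ι → ℝ), ((F.U t - 1) *ᵥ v) ⬝ᵥ ((F.U t - 1) *ᵥ v) ≤ (ℓ * t) ^ 2 * (v ⬝ᵥ v))
    (κ : ℝ) {n : ℕ} (hn : 1 ≤ n) (N : Fin (d + 1) → ℕ) (A₀ : ↥(boxDom N) → ↥(boxDom N) → ℝ)
    (hanti : ∀ x y, A₀ y x = -A₀ x y) {A' : ↥(boxDom N) → ↥(boxDom N) → ℝ} {θ θ' : ℝ} (hθ : 0 ≤ θ)
    (hA' : ∀ x y, y.1 ∈ nbrs x.1 → |κ * A' x y| ≤ θ / n) (hθ' : 0 ≤ θ')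
    (hder : ∀ (x z y : ↥(boxDom N)) (μ : Fin (d + 1)), z.1 = x.1 + e1 μ → y.1 = z.1 + e1 μ →
      |κ * (A' y z - A' z x)| ≤ θ' / (n : ℝ) ^ 2 ∧ |κ * (A' x z - A' z y)| ≤ θ' / (n : ℝ) ^ 2)
    (hbd : ∀ (x y : ↥(boxDom N)) (μ : Fin (d + 1)), y.1 = x.1 + e1 μ →
      (x.1 - e1 μ ∉ boxDom N ∨ y.1 + e1 μ ∉ boxDom N) → A' x y = 0 ∧ A' y x = 0)
    {p : ℝ} (hp : 1 ≤ p) (u : ↥(boxDom N) × ι → ℝ) :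
    lpM p (crossOp (boxWt n N) (fieldLink F κ A₀) (pertE (fieldLink F κ A')) *ᵥ u)
      ≤ ℓ * θ * ∑ μ, lpM p (covDeriv n (boxDom N) (fieldLink F κ A₀) μ *ᵥ u)
        + ((d : ℝ) + 1) * ℓ * θ' * lpM p u := by
  have hn0 : (0 : ℝ) < n := by exact_mod_cast hn
  have hρ : 0 ≤ ℓ * (θ / n) := mul_nonneg hℓ (div_nonneg hθ hn0.le)
  have hsite : ∀ z, siteNorm (fld (crossOp (boxWt n N) (fieldLink F κ A₀) (pertE (fieldLink F κ A')) *ᵥ u) z)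
      ≤ (n : ℝ) / 2 * (ℓ * (θ / n)) * ∑ μ, (siteNorm (fld (covDeriv n (boxDom N) (fieldLink F κ A₀) μ *ᵥ u) z)
          + (if h : z.1 - e1 μ ∈ boxDom N then
              siteNorm (fld (covDeriv n (boxDom N) (fieldLink F κ A₀) μ *ᵥ u) ⟨z.1 - e1 μ, h⟩) else 0))
        + ((d : ℝ) + 1) * ℓ * θ' * siteNorm (fld u z) := by
    intro z
    rw [cross_site_eq F κ n N A₀ hanti A' u z]
    refine (siteNorm_add_le _ _).trans (add_le_add ?_ (cross_zeroth_le F hℓ hLip κ hn N hθ' hder hbd u z))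
    refine bondSum_site F κ hn N A₀ hanti z hρ (fun y hy v => ?_) u
    exact (pertE_mulVec_le F hℓ hLip κ A' y z v).trans
      (mul_le_mul_of_nonneg_right (mul_le_mul_of_nonneg_left (hA' y z (nbrs_comm.1 hy)) hℓ) (siteNorm_nonneg _))
  unfold lpM
  refine (lpS_le_of_dirs_add hp (by positivity) (by positivity)
    (fun μ => covDeriv n (boxDom N) (fieldLink F κ A₀) μ *ᵥ u) u (fun z => siteNorm_nonneg _) hsite).trans
    (le_of_eq ?_)
  unfold lpM
  field_simp

/-- **`‖F₁^*F₁u‖_p ≤ (d+1)ℓ²θ²‖u‖_p`**. [cite: Balaban1983RegularityDecay, p. 581 (2.32)] -/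
theorem quad_lp (F : OrthFlow ι) {ℓ : ℝ} (hℓ : 0 ≤ ℓ)
    (hLip : ∀ t (v : ι → ℝ), ((F.U t - 1) *ᵥ v) ⬝ᵥ ((F.U t - 1) *ᵥ v) ≤ (ℓ * t) ^ 2 * (v ⬝ᵥ v))
    (κ : ℝ) {n : ℕ} (hn : 1 ≤ n) (N : Fin (d + 1) → ℕ) {A' : ↥(boxDom N) → ↥(boxDom N) → ℝ} {θ : ℝ}
    (hθ : 0 ≤ θ) (hA' : ∀ x y, y.1 ∈ nbrs x.1 → |κ * A' x y| ≤ θ / n) {p : ℝ} (hp : 1 ≤ p)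
    (u : ↥(boxDom N) × ι → ℝ) :
    lpM p (quadOp (boxWt n N) (pertE (fieldLink F κ A')) *ᵥ u) ≤ ((d : ℝ) + 1) * ℓ ^ 2 * θ ^ 2 * lpM p u :=
  lpM_le_of_pt hp (by positivity) fun z => quad_site_pt F hℓ hLip κ hn N hθ hA' u z

end Box

/-! ## §4 The `a`-terms in `‖·‖_p`: composite block kernels with equal row and column sums -/

section ATerms

variable {d : ℕ} (F : OrthFlow ι) {ℓ : ℝ} (κ : ℝ) {n : ℕ} (M : Fin (d + 1) → ℕ)
  (emb : ↥(boxDom M) → ↥(boxDom fun i => n * M i))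
  (Γ : ↥(boxDom M) → ↥(boxDom fun i => n * M i) → List ↥(boxDom fun i => n * M i))
  (A₀ A' : ↥(boxDom fun i => n * M i) → ↥(boxDom fun i => n * M i) → ℝ) {τ : ℝ}

/-- sitewise kernel bound for `Q_k(A₀)`: `|(Qu)(y)| ≤ Σ_x w(y,x)|u(x)|`. [cite: Balaban1983RegularityDecay, p. 572 (1.4)] -/
theorem avg_pt (u : ↥(boxDom fun i => n * M i) × ι → ℝ) (y : ↥(boxDom M)) :
    siteNorm (fld (avgOp (blkWt n M fun i => n * M i) (contourTrans (fieldLink F κ A₀) emb Γ) *ᵥ u) y)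
      ≤ ∑ x, blkWt n M (fun i => n * M i) y x * siteNorm (fld u x) := by
  rw [fld_avgOp_mulVec]
  refine (siteNorm_sum_le _ _).trans (sum_le_sum fun x _ => le_of_eq ?_)
  rw [siteNorm_smul, abs_of_nonneg (blkWt_nonneg n M _ y x), contourTrans_fieldLink, siteNorm_flow]

/-- sitewise kernel bound for `F₂`: `|(F₂u)(y)| ≤ Σ_x w(y,x)ℓτ|u(x)|` under `|κA'(Γ_{y,x})| ≤ τ`.
[cite: Balaban1983RegularityDecay, p. 580] -/
theorem pertF_pt (hℓ : 0 ≤ ℓ)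
    (hLip : ∀ t (v : ι → ℝ), ((F.U t - 1) *ᵥ v) ⬝ᵥ ((F.U t - 1) *ᵥ v) ≤ (ℓ * t) ^ 2 * (v ⬝ᵥ v))
    (hτ : ∀ y x, blkWt n M (fun i => n * M i) y x ≠ 0 → |κ * lsum A' (emb y) (Γ y x)| ≤ τ)
    (u : ↥(boxDom fun i => n * M i) × ι → ℝ) (y : ↥(boxDom M)) :
    siteNorm (fld (pertF (blkWt n M fun i => n * M i) (contourTrans (fieldLink F κ A') emb Γ)
        (contourTrans (fieldLink F κ A₀) emb Γ) *ᵥ u) y)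
      ≤ ∑ x, (blkWt n M (fun i => n * M i) y x * (ℓ * τ)) * siteNorm (fld u x) := by
  rw [pertF, fld_avgOp_mulVec]
  refine (siteNorm_sum_le _ _).trans (sum_le_sum fun x _ => ?_)
  rw [siteNorm_smul, abs_of_nonneg (blkWt_nonneg n M _ y x), mul_assoc]
  by_cases hq : blkWt n M (fun i => n * M i) y x = 0
  · rw [hq, zero_mul, zero_mul]
  refine mul_le_mul_of_nonneg_left ?_ (blkWt_nonneg n M _ y x)
  rw [kmul_apply, pertT, ← mulVec_mulVec, contourTrans_fieldLink, contourTrans_fieldLink]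
  refine (siteNorm_flow_sub_one_le F hℓ hLip _ _).trans ?_
  rw [siteNorm_flow]
  exact mul_le_mul_of_nonneg_right (mul_le_mul_of_nonneg_left (hτ y x hq) hℓ) (siteNorm_nonneg _)

/-- sitewise kernel bound for `Q_k(A₀)ᵀ`: `|(Qᵀw)(x)| ≤ Σ_y w(y,x)|w(y)|`. [cite: Balaban1983RegularityDecay, p. 572 (1.5)] -/
theorem avgT_pt (w : ↥(boxDom M) × ι → ℝ) (x : ↥(boxDom fun i => n * M i)) :
    siteNorm (fld ((avgOp (blkWt n M fun i => n * M i) (contourTrans (fieldLink F κ A₀) emb Γ))ᵀ *ᵥ w) x)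
      ≤ ∑ y, blkWt n M (fun i => n * M i) y x * siteNorm (fld w y) := by
  rw [fld_avgOp_transpose_mulVec]
  refine (siteNorm_sum_le _ _).trans (sum_le_sum fun y _ => le_of_eq ?_)
  rw [siteNorm_smul, abs_of_nonneg (blkWt_nonneg n M _ y x), contourTrans_fieldLink, F.transpose_eq, siteNorm_flow]

/-- sitewise kernel bound for `F₂ᵀ`: `|(F₂ᵀw)(x)| ≤ Σ_y w(y,x)ℓτ|w(y)|`. [cite: Balaban1983RegularityDecay, p. 580] -/
theorem pertFT_pt (hℓ : 0 ≤ ℓ)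
    (hLip : ∀ t (v : ι → ℝ), ((F.U t - 1) *ᵥ v) ⬝ᵥ ((F.U t - 1) *ᵥ v) ≤ (ℓ * t) ^ 2 * (v ⬝ᵥ v))
    (hτ : ∀ y x, blkWt n M (fun i => n * M i) y x ≠ 0 → |κ * lsum A' (emb y) (Γ y x)| ≤ τ)
    (w : ↥(boxDom M) × ι → ℝ) (x : ↥(boxDom fun i => n * M i)) :
    siteNorm (fld ((pertF (blkWt n M fun i => n * M i) (contourTrans (fieldLink F κ A') emb Γ)
        (contourTrans (fieldLink F κ A₀) emb Γ))ᵀ *ᵥ w) x)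
      ≤ ∑ y, (blkWt n M (fun i => n * M i) y x * (ℓ * τ)) * siteNorm (fld w y) := by
  rw [pertF, fld_avgOp_transpose_mulVec]
  refine (siteNorm_sum_le _ _).trans (sum_le_sum fun y _ => ?_)
  rw [siteNorm_smul, abs_of_nonneg (blkWt_nonneg n M _ y x), mul_assoc]
  by_cases hq : blkWt n M (fun i => n * M i) y x = 0
  · rw [hq, zero_mul, zero_mul]
  refine mul_le_mul_of_nonneg_left ?_ (blkWt_nonneg n M _ y x)
  rw [kmul_apply, pertT, Matrix.transpose_mul, ← mulVec_mulVec, contourTrans_fieldLink, contourTrans_fieldLink,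
    F.transpose_eq, siteNorm_flow, Matrix.transpose_sub, Matrix.transpose_one, F.transpose_eq]
  refine (siteNorm_flow_sub_one_le F hℓ hLip _ _).trans ?_
  rw [abs_neg]
  exact mul_le_mul_of_nonneg_right (mul_le_mul_of_nonneg_left (hτ y x hq) hℓ) (siteNorm_nonneg _)

/-- **THE `a`-TERMS ARE ZEROTH-ORDER SMALL IN `‖·‖_p`**: `‖a(F₂^*Q₀ + Q₀^*F₂ + F₂^*F₂)u‖_p ≤
|a|·n^{d+1}·ℓτ(2+ℓτ)·‖u‖_p` for every `p ≥ 1` — each product `F₂^*Q₀`, `Q₀^*F₂`, `F₂^*F₂` is a fine-lattice kernel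
with row AND column sums `≤ n^{d+1}ℓτ` (resp. `n^{d+1}(ℓτ)²`), so the Schur test applies with a `p`-independent
constant. [cite: Balaban1983RegularityDecay, p. 581 (2.32); p. 579 (2.24)] -/
theorem aterm_lpM_le (hℓ : 0 ≤ ℓ)
    (hLip : ∀ t (v : ι → ℝ), ((F.U t - 1) *ᵥ v) ⬝ᵥ ((F.U t - 1) *ᵥ v) ≤ (ℓ * t) ^ 2 * (v ⬝ᵥ v))
    (hn : 1 ≤ n) (hτ0 : 0 ≤ τ)
    (hτ : ∀ y x, blkWt n M (fun i => n * M i) y x ≠ 0 → |κ * lsum A' (emb y) (Γ y x)| ≤ τ) (a : ℝ)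
    {p : ℝ} (hp : 1 ≤ p) (u : ↥(boxDom fun i => n * M i) × ι → ℝ) :
    lpM p ((a • ((pertF (blkWt n M fun i => n * M i) (contourTrans (fieldLink F κ A') emb Γ)
          (contourTrans (fieldLink F κ A₀) emb Γ))ᵀ
        * avgOp (blkWt n M fun i => n * M i) (contourTrans (fieldLink F κ A₀) emb Γ)
      + (avgOp (blkWt n M fun i => n * M i) (contourTrans (fieldLink F κ A₀) emb Γ))ᵀ
        * pertF (blkWt n M fun i => n * M i) (contourTrans (fieldLink F κ A') emb Γ)
          (contourTrans (fieldLink F κ A₀) emb Γ)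
      + (pertF (blkWt n M fun i => n * M i) (contourTrans (fieldLink F κ A') emb Γ)
          (contourTrans (fieldLink F κ A₀) emb Γ))ᵀ
        * pertF (blkWt n M fun i => n * M i) (contourTrans (fieldLink F κ A') emb Γ)
          (contourTrans (fieldLink F κ A₀) emb Γ))) *ᵥ u)
      ≤ |a| * ((n : ℝ) ^ (d + 1) * (ℓ * τ * (2 + ℓ * τ))) * lpM p u := by
  set Q := avgOp (blkWt n M fun i => n * M i) (contourTrans (fieldLink F κ A₀) emb Γ) with hQ
  set P := pertF (blkWt n M fun i => n * M i) (contourTrans (fieldLink F κ A') emb Γ)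
    (contourTrans (fieldLink F κ A₀) emb Γ) with hP
  have hp0 : 0 < p := by linarith
  have hu := lpM_nonneg p u
  have hℓτ : 0 ≤ ℓ * τ := mul_nonneg hℓ hτ0
  have hnp : 0 ≤ (n : ℝ) ^ (d + 1) := by positivity
  have hw : ∀ y x, 0 ≤ blkWt n M (fun i => n * M i) y x := fun y x => blkWt_nonneg n M _ y x
  have hw' : ∀ y x, 0 ≤ blkWt n M (fun i => n * M i) y x * (ℓ * τ) := fun y x => mul_nonneg (hw y x) hℓτ
  have hQrow : ∀ y, ∑ x, blkWt n M (fun i => n * M i) y x ≤ (n : ℝ) ^ (d + 1) := fun y => sum_blkWt_row hn M y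
  have hQcol : ∀ x, ∑ y, blkWt n M (fun i => n * M i) y x ≤ 1 := fun x => sum_blkWt_col n M _ x
  have hProw : ∀ y, ∑ x, blkWt n M (fun i => n * M i) y x * (ℓ * τ) ≤ (n : ℝ) ^ (d + 1) * (ℓ * τ) := fun y => by
    rw [← sum_mul]; exact mul_le_mul_of_nonneg_right (hQrow y) hℓτ
  have hPcol : ∀ x, ∑ y, blkWt n M (fun i => n * M i) y x * (ℓ * τ) ≤ 1 * (ℓ * τ) := fun x => by
    rw [← sum_mul]; exact mul_le_mul_of_nonneg_right (hQcol x) hℓτ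
  have hQ_pt : ∀ (v : ↥(boxDom fun i => n * M i) × ι → ℝ) y,
      siteNorm (fld (Q *ᵥ v) y) ≤ ∑ x, blkWt n M (fun i => n * M i) y x * siteNorm (fld v x) :=
    fun v y => avg_pt F κ M emb Γ A₀ v y
  have hP_pt : ∀ (v : ↥(boxDom fun i => n * M i) × ι → ℝ) y, siteNorm (fld (P *ᵥ v) y)
      ≤ ∑ x, (blkWt n M (fun i => n * M i) y x * (ℓ * τ)) * siteNorm (fld v x) :=
    fun v y => pertF_pt F κ M emb Γ A₀ A' hℓ hLip hτ v y
  have hQT_pt : ∀ (w : ↥(boxDom M) × ι → ℝ) x,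
      siteNorm (fld (Qᵀ *ᵥ w) x) ≤ ∑ y, blkWt n M (fun i => n * M i) y x * siteNorm (fld w y) :=
    fun w x => avgT_pt F κ M emb Γ A₀ w x
  have hPT_pt : ∀ (w : ↥(boxDom M) × ι → ℝ) x, siteNorm (fld (Pᵀ *ᵥ w) x)
      ≤ ∑ y, (blkWt n M (fun i => n * M i) y x * (ℓ * τ)) * siteNorm (fld w y) :=
    fun w x => pertFT_pt F κ M emb Γ A₀ A' hℓ hLip hτ w x
  have h1 : lpM p ((Pᵀ * Q) *ᵥ u) ≤ (n : ℝ) ^ (d + 1) * (ℓ * τ) * lpM p u := by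
    rw [← mulVec_mulVec]
    refine lpM_le_of_site hp _ u (fun x x' => ∑ y, (blkWt n M (fun i => n * M i) y x * (ℓ * τ))
      * blkWt n M (fun i => n * M i) y x') (fun _ _ => sum_nonneg fun y _ => mul_nonneg (hw' _ _) (hw _ _))
      (comp_site_le (k₁ := fun x y => blkWt n M (fun i => n * M i) y x * (ℓ * τ)) (fun _ _ => hw' _ _)
        (hPT_pt (Q *ᵥ u)) (hQ_pt u)) (mul_nonneg hnp hℓτ) (fun x => ?_) (fun x' => ?_)
    · refine (comp_row_le (k₁ := fun x y => blkWt n M (fun i => n * M i) y x * (ℓ * τ)) (fun _ _ => hw' _ _)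
        hnp hPcol hQrow x).trans (le_of_eq ?_)
      ring
    · refine (comp_col_le (k₁ := fun x y => blkWt n M (fun i => n * M i) y x * (ℓ * τ))
        (k₂ := fun y x' => blkWt n M (fun i => n * M i) y x') (fun _ _ => hw _ _) (mul_nonneg hnp hℓτ) hProw
        hQcol x').trans (le_of_eq ?_)
      ring
  have h2 : lpM p ((Qᵀ * P) *ᵥ u) ≤ (n : ℝ) ^ (d + 1) * (ℓ * τ) * lpM p u := by
    rw [← mulVec_mulVec]
    refine lpM_le_of_site hp _ u (fun x x' => ∑ y, blkWt n M (fun i => n * M i) y x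
      * (blkWt n M (fun i => n * M i) y x' * (ℓ * τ))) (fun _ _ => sum_nonneg fun y _ => mul_nonneg (hw _ _) (hw' _ _))
      (comp_site_le (k₁ := fun x y => blkWt n M (fun i => n * M i) y x) (fun _ _ => hw _ _)
        (hQT_pt (P *ᵥ u)) (hP_pt u)) (mul_nonneg hnp hℓτ) (fun x => ?_) (fun x' => ?_)
    · refine (comp_row_le (k₁ := fun x y => blkWt n M (fun i => n * M i) y x) (fun _ _ => hw _ _)
        (mul_nonneg hnp hℓτ) hQcol hProw x).trans (le_of_eq ?_)
      ring
    · refine (comp_col_le (k₁ := fun x y => blkWt n M (fun i => n * M i) y x)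
        (k₂ := fun y x' => blkWt n M (fun i => n * M i) y x' * (ℓ * τ)) (fun _ _ => hw' _ _) hnp hQrow
        hPcol x').trans (le_of_eq ?_)
      ring
  have h3 : lpM p ((Pᵀ * P) *ᵥ u) ≤ (n : ℝ) ^ (d + 1) * (ℓ * τ) * (ℓ * τ) * lpM p u := by
    rw [← mulVec_mulVec]
    refine lpM_le_of_site hp _ u (fun x x' => ∑ y, (blkWt n M (fun i => n * M i) y x * (ℓ * τ))
      * (blkWt n M (fun i => n * M i) y x' * (ℓ * τ)))
      (fun _ _ => sum_nonneg fun y _ => mul_nonneg (hw' _ _) (hw' _ _))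
      (comp_site_le (k₁ := fun x y => blkWt n M (fun i => n * M i) y x * (ℓ * τ)) (fun _ _ => hw' _ _)
        (hPT_pt (P *ᵥ u)) (hP_pt u)) (mul_nonneg (mul_nonneg hnp hℓτ) hℓτ) (fun x => ?_) (fun x' => ?_)
    · refine (comp_row_le (k₁ := fun x y => blkWt n M (fun i => n * M i) y x * (ℓ * τ)) (fun _ _ => hw' _ _)
        (mul_nonneg hnp hℓτ) hPcol hProw x).trans (le_of_eq ?_)
      ring
    · refine (comp_col_le (k₁ := fun x y => blkWt n M (fun i => n * M i) y x * (ℓ * τ))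
        (k₂ := fun y x' => blkWt n M (fun i => n * M i) y x' * (ℓ * τ)) (fun _ _ => hw' _ _)
        (mul_nonneg hnp hℓτ) hProw hPcol x').trans (le_of_eq ?_)
      ring
  rw [smul_mulVec, lpM_smul hp0.ne', mul_assoc]
  refine mul_le_mul_of_nonneg_left ?_ (abs_nonneg a)
  rw [add_mulVec, add_mulVec]
  refine ((lpM_add_le hp _ _).trans (add_le_add ((lpM_add_le hp _ _).trans (add_le_add h1 h2)) h3)).trans ?_
  have : (n : ℝ) ^ (d + 1) * (ℓ * τ) * lpM p u + (n : ℝ) ^ (d + 1) * (ℓ * τ) * lpM p u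
      + (n : ℝ) ^ (d + 1) * (ℓ * τ) * (ℓ * τ) * lpM p u
      = (n : ℝ) ^ (d + 1) * (ℓ * τ * (2 + ℓ * τ)) * lpM p u := by
    ring
  rw [this]

/-- the same with [B4]'s coefficient `a = a_k·n^{-(d+1)}`, `a_k ≥ 0`: `≤ a_kℓτ(2+ℓτ)‖u‖_p`.
[cite: Balaban1983RegularityDecay, p. 581 (2.32)] -/
theorem aterm_lpM_le' (hℓ : 0 ≤ ℓ)
    (hLip : ∀ t (v : ι → ℝ), ((F.U t - 1) *ᵥ v) ⬝ᵥ ((F.U t - 1) *ᵥ v) ≤ (ℓ * t) ^ 2 * (v ⬝ᵥ v))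
    (hn : 1 ≤ n) (hτ0 : 0 ≤ τ)
    (hτ : ∀ y x, blkWt n M (fun i => n * M i) y x ≠ 0 → |κ * lsum A' (emb y) (Γ y x)| ≤ τ) {ak : ℝ}
    (hak : 0 ≤ ak) {p : ℝ} (hp : 1 ≤ p) (u : ↥(boxDom fun i => n * M i) × ι → ℝ) :
    lpM p (((ak * ((n : ℝ) ^ (d + 1))⁻¹) • ((pertF (blkWt n M fun i => n * M i)
          (contourTrans (fieldLink F κ A') emb Γ) (contourTrans (fieldLink F κ A₀) emb Γ))ᵀ
        * avgOp (blkWt n M fun i => n * M i) (contourTrans (fieldLink F κ A₀) emb Γ)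
      + (avgOp (blkWt n M fun i => n * M i) (contourTrans (fieldLink F κ A₀) emb Γ))ᵀ
        * pertF (blkWt n M fun i => n * M i) (contourTrans (fieldLink F κ A') emb Γ)
          (contourTrans (fieldLink F κ A₀) emb Γ)
      + (pertF (blkWt n M fun i => n * M i) (contourTrans (fieldLink F κ A') emb Γ)
          (contourTrans (fieldLink F κ A₀) emb Γ))ᵀ
        * pertF (blkWt n M fun i => n * M i) (contourTrans (fieldLink F κ A') emb Γ)
          (contourTrans (fieldLink F κ A₀) emb Γ))) *ᵥ u)
      ≤ ak * (ℓ * τ * (2 + ℓ * τ)) * lpM p u := by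
  have hn0 : (0 : ℝ) < (n : ℝ) ^ (d + 1) := by positivity
  refine (aterm_lpM_le F κ M emb Γ A₀ A' hℓ hLip hn hτ0 hτ _ hp u).trans (le_of_eq ?_)
  rw [abs_of_nonneg (by positivity), mul_assoc ak, ← mul_assoc (((n : ℝ) ^ (d + 1))⁻¹), inv_mul_cancel₀ hn0.ne',
    one_mul]

end ATerms

/-! ## §5 `V_k` IS FIRST-ORDER SMALL IN `‖·‖_p` RELATIVE TO `(D^η_{A₀,μ})_μ` -/

section Assembly

variable {d : ℕ}

/-- **`−V = vOp` IS FIRST-ORDER SMALL IN `‖·‖_p` (`p ≥ 1`) RELATIVE TO `(D^η_{A₀,μ})_μ`** on the fine box, under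
the hypotheses of `B4Lemma22L1Stair.firstOrderSmall_vOp_l1`, with the same constant
`(ℓθ + (d+1)ℓθ') + ℓθ + (d+1)ℓ²θ² + a_kℓτ(2+ℓτ)` (independent of `p`). [cite: Balaban1983RegularityDecay, p. 581 (2.32)] -/
theorem firstOrderSmall_vOp_lp (F : OrthFlow ι) {ℓ : ℝ} (hℓ : 0 ≤ ℓ)
    (hLip : ∀ t (v : ι → ℝ), ((F.U t - 1) *ᵥ v) ⬝ᵥ ((F.U t - 1) *ᵥ v) ≤ (ℓ * t) ^ 2 * (v ⬝ᵥ v))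
    (κ : ℝ) {n : ℕ} (hn : 1 ≤ n) (M : Fin (d + 1) → ℕ) (emb : ↥(boxDom M) → ↥(boxDom fun i => n * M i))
    (Γ : ↥(boxDom M) → ↥(boxDom fun i => n * M i) → List ↥(boxDom fun i => n * M i))
    (A₀ : ↥(boxDom fun i => n * M i) → ↥(boxDom fun i => n * M i) → ℝ) (hanti : ∀ x y, A₀ y x = -A₀ x y)
    {A' : ↥(boxDom fun i => n * M i) → ↥(boxDom fun i => n * M i) → ℝ} {θ θ' τ ak : ℝ} (hθ : 0 ≤ θ)
    (hA' : ∀ x y, y.1 ∈ nbrs x.1 → |κ * A' x y| ≤ θ / n) (hθ' : 0 ≤ θ')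
    (hder : ∀ (x z y : ↥(boxDom fun i => n * M i)) (μ : Fin (d + 1)), z.1 = x.1 + e1 μ → y.1 = z.1 + e1 μ →
      |κ * (A' y z - A' z x)| ≤ θ' / (n : ℝ) ^ 2 ∧ |κ * (A' x z - A' z y)| ≤ θ' / (n : ℝ) ^ 2)
    (hbd : ∀ (x y : ↥(boxDom fun i => n * M i)) (μ : Fin (d + 1)), y.1 = x.1 + e1 μ →
      (x.1 - e1 μ ∉ boxDom (fun i => n * M i) ∨ y.1 + e1 μ ∉ boxDom (fun i => n * M i)) →
      A' x y = 0 ∧ A' y x = 0)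
    (hτ0 : 0 ≤ τ) (hτ : ∀ y x, blkWt n M (fun i => n * M i) y x ≠ 0 → |κ * lsum A' (emb y) (Γ y x)| ≤ τ)
    (hak : 0 ≤ ak) {p : ℝ} (hp : 1 ≤ p) :
    FirstOrderSmall (lpM p)
      (-vOp (boxWt n fun i => n * M i) (ak * ((n : ℝ) ^ (d + 1))⁻¹) (blkWt n M fun i => n * M i)
        (fieldLink F κ A') (fieldLink F κ A₀) (contourTrans (fieldLink F κ A') emb Γ)
        (contourTrans (fieldLink F κ A₀) emb Γ))
      (covDeriv n (boxDom fun i => n * M i) (fieldLink F κ A₀))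
      (ℓ * θ + ((d : ℝ) + 1) * ℓ * θ' + ℓ * θ + ((d : ℝ) + 1) * ℓ ^ 2 * θ ^ 2 + ak * (ℓ * τ * (2 + ℓ * τ))) := by
  refine firstOrderSmall_neg' (lpM_neg p) ?_
  rw [vOp]
  have hC : FirstOrderSmall (lpM p)
      (crossOp (boxWt n fun i => n * M i) (fieldLink F κ A₀) (pertE (fieldLink F κ A')))
      (covDeriv n (boxDom fun i => n * M i) (fieldLink F κ A₀)) (ℓ * θ + ((d : ℝ) + 1) * ℓ * θ') :=
    firstOrderSmall_of_le' (lpM_nonneg p) (by positivity) (mul_nonneg hℓ hθ) fun u =>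
      cross_lp F hℓ hLip κ hn _ A₀ hanti hθ hA' hθ' hder hbd hp u
  have hCT : FirstOrderSmall (lpM p)
      (crossOp (boxWt n fun i => n * M i) (fieldLink F κ A₀) (pertE (fieldLink F κ A')))ᵀ
      (covDeriv n (boxDom fun i => n * M i) (fieldLink F κ A₀)) (ℓ * θ) := by
    have key := firstOrderSmall_of_le' (ε₀ := 0) (lpM_nonneg p) le_rfl (mul_nonneg hℓ hθ) fun u => by
      rw [zero_mul, add_zero]; exact crossT_lp F hℓ hLip κ hn _ A₀ hanti hθ hA' hp u
    rwa [add_zero] at key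
  have hQ : FirstOrderSmall (lpM p) (quadOp (boxWt n fun i => n * M i) (pertE (fieldLink F κ A')))
      (covDeriv n (boxDom fun i => n * M i) (fieldLink F κ A₀)) (((d : ℝ) + 1) * ℓ ^ 2 * θ ^ 2) :=
    firstOrderSmall_of_zeroth' (lpM_nonneg p) _ (by positivity) fun u => quad_lp F hℓ hLip κ hn _ hθ hA' hp u
  exact firstOrderSmall_add' (lpM_add_le hp) (firstOrderSmall_add' (lpM_add_le hp)
    (firstOrderSmall_add' (lpM_add_le hp) hC hCT) hQ) (firstOrderSmall_of_zeroth' (lpM_nonneg p) _ (by positivity)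
      fun u => aterm_lpM_le' F κ M emb Γ A₀ A' hℓ hLip hn hτ0 hτ hak hp u)

/-- **[B4]'s `V` OF (2.24)/(2.31) (`B4Lemma22ReduceZero.pertV`) IS FIRST-ORDER SMALL IN `‖·‖_p` (`p ≥ 1`) RELATIVE
TO `D^η_{A₀}`**, with the `p`-independent constant of the sup row
`(d+1)ℓ₁(θ+θ') + (d+1)ℓ₁θ + (d+1)ℓ₁²θ² + a_kℓ₁τ(2+ℓ₁τ)`.
[cite: Balaban1983RegularityDecay, p. 581 (2.32); pp. 579–580 (2.24)–(2.25)] -/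
theorem firstOrderSmall_pertV_lp (F : OrthFlow ι) {ℓ₁ : ℝ} (hℓ₁ : 0 ≤ ℓ₁)
    (hLip : ∀ t (v : ι → ℝ), ((F.U t - 1) *ᵥ v) ⬝ᵥ ((F.U t - 1) *ᵥ v) ≤ (ℓ₁ * t) ^ 2 * (v ⬝ᵥ v))
    (κ : ℝ) {ℓ k : ℕ} (hℓ : 1 ≤ ℓ) (hk : 1 ≤ k) {a : ℝ} (ha : 0 < a) (M : Fin (d + 1) → ℕ)
    (emb : ↥(boxDom M) → ↥(Box d ℓ k M)) (Γ : ↥(boxDom M) → ↥(Box d ℓ k M) → List ↥(Box d ℓ k M))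
    (A₀ : Fin (d + 1) → ℝ) {A' : ↥(Box d ℓ k M) → ↥(Box d ℓ k M) → ℝ} {θ θ' τ : ℝ} (hθ : 0 ≤ θ)
    (hA' : ∀ x y : ↥(Box d ℓ k M), y.1 ∈ nbrs x.1 → |κ * A' x y| ≤ θ / ((ℓ + 1) ^ k : ℕ)) (hθ' : 0 ≤ θ')
    (hder : ∀ (x z y : ↥(Box d ℓ k M)) (μ : Fin (d + 1)), z.1 = x.1 + e1 μ → y.1 = z.1 + e1 μ →
      |κ * (A' y z - A' z x)| ≤ θ' / (((ℓ + 1) ^ k : ℕ) : ℝ) ^ 2 ∧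
      |κ * (A' x z - A' z y)| ≤ θ' / (((ℓ + 1) ^ k : ℕ) : ℝ) ^ 2)
    (hbd : ∀ (x y : ↥(Box d ℓ k M)) (μ : Fin (d + 1)), y.1 = x.1 + e1 μ →
      (x.1 - e1 μ ∉ Box d ℓ k M ∨ y.1 + e1 μ ∉ Box d ℓ k M) → A' x y = 0 ∧ A' y x = 0)
    (hτ0 : 0 ≤ τ)
    (hτ : ∀ y x, blkWt ((ℓ + 1) ^ k) M (fun i => (ℓ + 1) ^ k * M i) y x ≠ 0 →
      |κ * lsum A' (emb y) (Γ y x)| ≤ τ) {p : ℝ} (hp : 1 ≤ p) :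
    FirstOrderSmall (lpM p) (pertV d F κ ℓ k a M emb Γ A₀ A') (derivA0 d F κ ℓ k M A₀)
      (((d : ℝ) + 1) * ℓ₁ * (θ + θ') + ((d : ℝ) + 1) * ℓ₁ * θ + ((d : ℝ) + 1) * ℓ₁ ^ 2 * θ ^ 2
        + B1.aSeq a ((ℓ : ℝ) + 1) k * (ℓ₁ * τ * (2 + ℓ₁ * τ))) := by
  have hn : 1 ≤ (ℓ + 1) ^ k := Nat.one_le_pow _ _ (Nat.succ_pos ℓ)
  have hL : (1 : ℝ) < (ℓ : ℝ) + 1 := by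
    have : (1 : ℝ) ≤ ℓ := by exact_mod_cast hℓ
    linarith
  have hak : 0 ≤ B1.aSeq a ((ℓ : ℝ) + 1) k := (B1.aSeq_pos ha hL hk).le
  have key := firstOrderSmall_vOp_lp F hℓ₁ hLip κ hn M emb Γ (constBond A₀ Subtype.val)
    (constBond_antisymm A₀ Subtype.val) hθ hA' hθ' hder hbd hτ0 hτ hak hp
  refine firstOrderSmall_mono' (lpM_nonneg p) key ?_
  have hd : 0 ≤ (d : ℝ) * ℓ₁ * θ := by positivity
  have hd' : 0 ≤ (d : ℝ) * ℓ₁ * θ' := by positivity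
  nlinarith

/-! ## §6 The zero-field and constant-field `‖·‖_p` hypotheses, and the `‖·‖_p` conversion bound -/

/-- **THE `A₀ = 0` `ℓ^p`-NORM HYPOTHESES** (every `p ≥ 1`, one constant): uniformly over the window,
`‖(G_k(□)⊗1)Φ‖_p ≤ c‖Φ‖_p` and `‖(D^η_μ⊗1)(G_k(□)⊗1)Φ‖_p ≤ c‖Φ‖_p` — (2.17) at `A = 0`, `q = p`, `n = 0,1`, from
the tree's zero-field ROW sums (`B4Thm110ZeroBox`, `B4Thm110ZeroBoxDeriv`) AND COLUMN sums (`lemma22_zero_box_colSum`,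
`B4Lemma22ZeroBoxDerivDual`) by the Schur test («The Riesz-Thorin Theorem implies it for arbitrary q = p from
[1,∞].» — here by the elementary Schur test instead). [cite: Balaban1983RegularityDecay, Lemma 2.2 (2.17) p. 578;
p. 583] -/
theorem zero_box_lp (ι : Type) [Fintype ι] [DecidableEq ι] (d ℓ : ℕ) (hℓ : 1 ≤ ℓ)
    (amin aplus m2plus : ℝ) (ha : 0 < amin) :
    ∃ c : ℝ, 0 < c ∧ ∀ (k : ℕ), 1 ≤ k → ∀ (a m2 : ℝ), amin ≤ a → a ≤ aplus → 0 ≤ m2 → m2 ≤ m2plus →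
      ∀ (M : Fin (d + 1) → ℕ), (∀ i, 1 ≤ M i) → ∀ (p : ℝ), 1 ≤ p →
        (∀ Φ : ↥(Box d ℓ k M) × ι → ℝ,
            lpM p ((gk d ℓ k a m2 M ⊗ₖ (1 : Matrix ι ι ℝ)) *ᵥ Φ) ≤ c * lpM p Φ) ∧
        (∀ (μ : Fin (d + 1)) (Φ : ↥(Box d ℓ k M) × ι → ℝ),
            lpM p ((dk d ℓ k M μ ⊗ₖ (1 : Matrix ι ι ℝ)) *ᵥ ((gk d ℓ k a m2 M ⊗ₖ (1 : Matrix ι ι ℝ)) *ᵥ Φ))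
              ≤ c * lpM p Φ) := by
  obtain ⟨c₁, hc₁, h₁⟩ := lemma22_zero_box_rowSum d ℓ hℓ amin aplus m2plus ha
  obtain ⟨c₁', hc₁', h₁'⟩ := lemma22_zero_box_colSum d ℓ hℓ amin aplus m2plus ha
  obtain ⟨c₂, hc₂, h₂⟩ := lemma22_zero_box_deriv_rowSum d ℓ hℓ amin aplus m2plus ha
  obtain ⟨c₂', hc₂', h₂'⟩ := lemma22_zero_box_deriv_colSum d ℓ hℓ amin aplus m2plus ha
  refine ⟨max (max c₁ c₁') (max c₂ c₂'), lt_max_of_lt_left (lt_max_of_lt_left hc₁), ?_⟩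
  intro k hk a m2 e1 e2 e3 e4 M hM p hp
  have hc0 : 0 ≤ max (max c₁ c₁') (max c₂ c₂') := le_max_of_le_left (le_max_of_le_left hc₁.le)
  refine ⟨fun Φ => ?_, fun μ Φ => ?_⟩
  · exact lpM_kron_le hp hc0
      (fun y => (h₁ k hk a m2 e1 e2 e3 e4 M hM y).trans ((le_max_left _ _).trans (le_max_left _ _)))
      (fun x' => (h₁' k hk a m2 e1 e2 e3 e4 M hM x').trans ((le_max_right _ _).trans (le_max_left _ _))) Φ
  · rw [kron_mulVec_kron_mulVec]
    refine lpM_kron_le hp hc0 (fun y => ?_) (fun x' => ?_) Φ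
    · exact (rowSum_fdiffM_mul_le _ hc₂.le (fun x xe hxe => h₂ k hk a m2 e1 e2 e3 e4 M hM μ x xe hxe) y).trans
        ((le_max_left _ _).trans (le_max_right _ _))
    · calc ∑ x, |(dk d ℓ k M μ * gk d ℓ k a m2 M) x x'|
            = ∑ x, |((((ℓ + 1) ^ k : ℕ) : ℝ)) * (gk d ℓ k a m2 M (fwd _ μ x) x' - gk d ℓ k a m2 M x x')| :=
              sum_congr rfl fun x _ => by rw [fdiffM_mul_apply_fwd]
        _ ≤ c₂' := h₂' k hk a m2 e1 e2 e3 e4 M hM μ x'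
        _ ≤ max (max c₁ c₁') (max c₂ c₂') := (le_max_right _ _).trans (le_max_right _ _)

/-- **THE CONSTANT-`A₀` `ℓ^p`-NORM HYPOTHESES** («Lemma 2.2 in the case of a constant configuration A₀ is equivalent
to the case of configuration A₀ = 0 by the same argument with the gauge transformation as before» — here for every
row `q = p ∈ [1,∞)`, members `G` and `D^η_μG`, on boxes): uniformly over the window, the box, the contour system,
`A₀` and `p`, `‖G_k(□,A₀)f‖_p ≤ c‖f‖_p` and `‖D^η_{A₀,μ}G_k(□,A₀)f‖_p ≤ c‖f‖_p`.
[cite: Balaban1983RegularityDecay, Lemma 2.2 (2.17) p. 578; p. 581; p. 583] -/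
theorem const_box_lp (F : OrthFlow ι) (κ : ℝ) (d ℓ : ℕ) (hℓ : 1 ≤ ℓ) (amin aplus m2plus : ℝ) (ha : 0 < amin) :
    ∃ c : ℝ, 0 < c ∧ ∀ (k : ℕ), 1 ≤ k → ∀ (a m2 : ℝ), amin ≤ a → a ≤ aplus → 0 ≤ m2 → m2 ≤ m2plus →
      ∀ (M : Fin (d + 1) → ℕ), (∀ i, 1 ≤ M i) →
      ∀ (emb : ↥(boxDom M) → ↥(Box d ℓ k M)) (Γ : ↥(boxDom M) → ↥(Box d ℓ k M) → List ↥(Box d ℓ k M)),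
        (∀ y x, blkWt ((ℓ + 1) ^ k) M (fun i => (ℓ + 1) ^ k * M i) y x ≠ 0 → pathEnd (emb y) (Γ y x) = x) →
      ∀ (A₀ : Fin (d + 1) → ℝ) (p : ℝ), 1 ≤ p →
        (∀ f : ↥(Box d ℓ k M) × ι → ℝ,
            lpM p (greenA0 d F κ ℓ k a m2 M emb Γ A₀ *ᵥ f) ≤ c * lpM p f) ∧
        (∀ (μ : Fin (d + 1)) (f : ↥(Box d ℓ k M) × ι → ℝ),
            lpM p (derivA0 d F κ ℓ k M A₀ μ *ᵥ (greenA0 d F κ ℓ k a m2 M emb Γ A₀ *ᵥ f)) ≤ c * lpM p f) := by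
  obtain ⟨c, hc, h⟩ := zero_box_lp ι d ℓ hℓ amin aplus m2plus ha
  refine ⟨c, hc, ?_⟩
  intro k hk a m2 e1 e2 e3 e4 M hM emb Γ hend A₀ p hp
  obtain ⟨h0, hD⟩ := h k hk a m2 e1 e2 e3 e4 M hM p hp
  have hL : (1 : ℝ) < (ℓ : ℝ) + 1 := by
    have : (1 : ℝ) ≤ (ℓ : ℝ) := by exact_mod_cast hℓ
    linarith
  have hak : 0 < B1.aSeq a ((ℓ : ℝ) + 1) k := B1.aSeq_pos (lt_of_lt_of_le ha e1) hL hk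
  have hn : 1 ≤ (ℓ + 1) ^ k := Nat.one_le_pow _ _ (Nat.succ_pos ℓ)
  have hS : IsUnit (scalarOp (boxWt ((ℓ + 1) ^ k) (fun i => (ℓ + 1) ^ k * M i)) m2
      (B1.aSeq a ((ℓ : ℝ) + 1) k * (((((ℓ + 1) ^ k : ℕ)) : ℝ) ^ (d + 1))⁻¹)
      (blkWt ((ℓ + 1) ^ k) M (fun i => (ℓ + 1) ^ k * M i))).det := by
    rw [scalarOp_box hn]
    exact boxOpR_det_isUnit hn hak e3 hM
  have hg : IsGauge (fun u : ↥(Box d ℓ k M) => F.U (κ * linGauge A₀ Subtype.val u)) := F.isGauge _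
  have hG : greenA0 d F κ ℓ k a m2 M emb Γ A₀
      = blockDiag (fun u : ↥(Box d ℓ k M) => F.U (κ * linGauge A₀ Subtype.val u))
          * (gk d ℓ k a m2 M ⊗ₖ (1 : Matrix ι ι ℝ))
          * (blockDiag fun u : ↥(Box d ℓ k M) => F.U (κ * linGauge A₀ Subtype.val u))ᵀ := by
    dsimp only [greenA0]
    rw [b4Green_constBond F κ _ m2 _ hend A₀ _ hS, scalarOp_box hn]
  have hDer : ∀ μ, derivA0 d F κ ℓ k M A₀ μ
      = blockDiag (fun u : ↥(Box d ℓ k M) => F.U (κ * linGauge A₀ Subtype.val u))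
          * (dk d ℓ k M μ ⊗ₖ (1 : Matrix ι ι ℝ))
          * (blockDiag fun u : ↥(Box d ℓ k M) => F.U (κ * linGauge A₀ Subtype.val u))ᵀ := fun μ => by
    dsimp only [derivA0]
    rw [covDeriv_constBond]
  obtain ⟨c0, cD⟩ := hyps_conj (κ := Fin (d + 1)) (D := fun μ => dk d ℓ k M μ ⊗ₖ (1 : Matrix ι ι ℝ))
    (lpM_gauge p hg) (lpM_gauge_transpose p hg) hg h0 hD
  refine ⟨fun f => ?_, fun μ f => ?_⟩
  · rw [hG]
    exact c0 f
  · rw [hG, hDer μ]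
    exact cD μ f

/-- **THE `ℓ^p` CONVERSION BOUND `‖(D^η_{Ã,μ} − D^η_{A₀,μ})u‖_p ≤ ℓθ‖u‖_p`** under `|κA'(x,x+e_μ)| ≤ θ/n` (sitewise
`≤ ℓθ|u(x+e_μ)|`, then the injective forward shift). [cite: Balaban1983RegularityDecay, p. 581] -/
theorem covDeriv_sub_lpM_le (F : OrthFlow ι) {ℓ : ℝ} (hℓ : 0 ≤ ℓ)
    (hLip : ∀ t (v : ι → ℝ), ((F.U t - 1) *ᵥ v) ⬝ᵥ ((F.U t - 1) *ᵥ v) ≤ (ℓ * t) ^ 2 * (v ⬝ᵥ v))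
    (κ : ℝ) {n : ℕ} (hn : 1 ≤ n) {R : Finset (Fin (d + 1) → ℤ)} (A₀ : ↥R → ↥R → ℝ) {A' : ↥R → ↥R → ℝ}
    {μ : Fin (d + 1)} {θ : ℝ} (hθ : 0 ≤ θ) (hA' : ∀ x y : ↥R, y.1 = x.1 + e1 μ → |κ * A' x y| ≤ θ / n)
    {p : ℝ} (hp : 1 ≤ p) (u : ↥R × ι → ℝ) :
    lpM p ((covDeriv n R (fieldLink F κ (A₀ + A')) μ - covDeriv n R (fieldLink F κ A₀) μ) *ᵥ u)
      ≤ ℓ * θ * lpM p u := by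
  have hn0 : (0 : ℝ) < n := by exact_mod_cast hn
  have hp0 : 0 < p := by linarith
  have hsite : ∀ x, siteNorm (fld ((covDeriv n R (fieldLink F κ (A₀ + A')) μ
      - covDeriv n R (fieldLink F κ A₀) μ) *ᵥ u) x)
      ≤ ℓ * θ * (if h : x.1 + e1 μ ∈ R then siteNorm (fld u ⟨x.1 + e1 μ, h⟩) else 0) := by
    intro x
    by_cases h : x.1 + e1 μ ∈ R
    · rw [dif_pos h, covDeriv_sub_fld_of_mem F κ n A₀ A' u h, siteNorm_smul, Nat.abs_cast]
      have h1 := siteNorm_flow_sub_one_le F hℓ hLip (κ * A' x ⟨x.1 + e1 μ, h⟩)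
        (fieldLink F κ A₀ x ⟨x.1 + e1 μ, h⟩ *ᵥ fld u ⟨x.1 + e1 μ, h⟩)
      have h2 : siteNorm (fieldLink F κ A₀ x ⟨x.1 + e1 μ, h⟩ *ᵥ fld u ⟨x.1 + e1 μ, h⟩)
          = siteNorm (fld u ⟨x.1 + e1 μ, h⟩) := siteNorm_flow F _ _
      rw [h2] at h1
      have h3 := hA' x ⟨x.1 + e1 μ, h⟩ rfl
      have h5 : 0 ≤ siteNorm (fld u ⟨x.1 + e1 μ, h⟩) := siteNorm_nonneg _
      calc (n : ℝ) * siteNorm ((F.U (κ * A' x ⟨x.1 + e1 μ, h⟩) - 1)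
              *ᵥ (fieldLink F κ A₀ x ⟨x.1 + e1 μ, h⟩ *ᵥ fld u ⟨x.1 + e1 μ, h⟩))
            ≤ (n : ℝ) * (ℓ * (θ / n) * siteNorm (fld u ⟨x.1 + e1 μ, h⟩)) := by
              refine mul_le_mul_of_nonneg_left (h1.trans ?_) hn0.le
              exact mul_le_mul_of_nonneg_right (mul_le_mul_of_nonneg_left h3 hℓ) h5
        _ = ℓ * θ * siteNorm (fld u ⟨x.1 + e1 μ, h⟩) := by field_simp
    · rw [dif_neg h, mul_zero, covDeriv_sub_fld_of_not_mem F κ n A₀ A' u h, siteNorm_zero]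
  unfold lpM
  calc _ ≤ lpS p (fun x : ↥R => ℓ * θ
          * (if h : x.1 + e1 μ ∈ R then siteNorm (fld u ⟨x.1 + e1 μ, h⟩) else 0)) :=
        lpS_mono' hp0 (fun x => siteNorm_nonneg _) hsite
    _ = ℓ * θ * lpS p (fun x : ↥R => if h : x.1 + e1 μ ∈ R then siteNorm (fld u ⟨x.1 + e1 μ, h⟩) else 0) :=
        lpS_const_mul hp0.ne' (mul_nonneg hℓ hθ) _
    _ ≤ ℓ * θ * lpS p (fun x => siteNorm (fld u x)) :=
        mul_le_mul_of_nonneg_left (lpS_shift_le hp0 (s := fun w => w + e1 μ) (add_left_injective _)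
          fun y => siteNorm (fld u y)) (mul_nonneg hℓ hθ)

/-! ## §7 LEMMA 2.2 (2.17) ON THE DIAGONAL `q = p ∈ [1,∞)` FOR `G_k(□,Ã)` ON A BOX -/

/-- **LEMMA 2.2 (2.17) FOR [B4]'s `G_k(□,Ã)`, `Ã = A₀ + A'`, ON A FINE BOX, EVERY ROW `q = p ∈ [1,∞)`, ALL THREE
MEMBERS `n ≤ 1`: `G`, `D^η_μG` AND `G D^{η*}_μ` (both derivative conventions each)**, with ONE constant `c`
independent of `p`, under EXACTLY the hypotheses of `B4Lemma22CrossSup.lemma22_17_sup_box` /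
`B4Lemma22L1Stair.lemma22_17_l1_box`: there is `c > 0` (uniform on the window `a ∈ [amin, aplus]`, `m² ∈ [0, m2plus]`,
all `k ≥ 1`, all boxes, all contour systems ending at the averaged point, all constant `A₀`, all `p`) such that IF
`H_k(□,Ã)` is invertible, `|κA'_b| ≤ θ/n` on nearest-neighbour bonds, `|κ(A'(b') − A'(b))| ≤ θ'/n²` on consecutive
parallel bonds, `A' = 0` on the `μ`-bonds touching the `μ`-faces, `|κA'(Γ_{y,x})| ≤ τ` along the block contours and
`(d+2)c((d+1)ℓ(θ+θ') + (d+1)ℓθ + (d+1)ℓ²θ² + a_kℓτ(2+ℓτ)) ≤ 1/2` («for e sufficiently small»), THEN for every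
`p ≥ 1` and every `f`: `‖Gf‖_p + Σ_μ‖D^η_{A₀,μ}Gf‖_p ≤ 2(d+2)c‖f‖_p`, `‖D^η_{Ã,μ}Gf‖_p ≤ (1+ℓθ)·2(d+2)c‖f‖_p`,
`‖G(D^η_{A₀,μ})ᵀf‖_p ≤ 2(d+2)c‖f‖_p`, `‖G(D^η_{Ã,μ})ᵀf‖_p ≤ (1+ℓθ)·2(d+2)c‖f‖_p` (`(D^η_μ)ᵀ = D^{η*}_μ`, the
real adjoint; `G = G_k(□,Ã)`).  Members 1–2: the (2.31)–(2.33) bootstrap in `‖·‖_p`; member 3: from member 2 by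
`Gᵀ = G` and duality — `L^p`/`L^{p'}` for `p > 1`, `L¹`/`L^∞` (the sup row `B4Lemma22CrossSup.lemma22_17_sup_box`)
for `p = 1`.
[cite: Balaban1983RegularityDecay, Lemma 2.2 (2.17) p. 578; proof pp. 579–583 (2.23)–(2.25), (2.31)–(2.33)] -/
theorem lemma22_17_lp_box (F : OrthFlow ι) {ℓ₁ : ℝ} (hℓ₁ : 0 ≤ ℓ₁)
    (hLip : ∀ t (v : ι → ℝ), ((F.U t - 1) *ᵥ v) ⬝ᵥ ((F.U t - 1) *ᵥ v) ≤ (ℓ₁ * t) ^ 2 * (v ⬝ᵥ v))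
    (κ : ℝ) (d ℓ : ℕ) (hℓ : 1 ≤ ℓ) (amin aplus m2plus : ℝ) (ha : 0 < amin) :
    ∃ c : ℝ, 0 < c ∧ ∀ (k : ℕ), 1 ≤ k → ∀ (a m2 : ℝ), amin ≤ a → a ≤ aplus → 0 ≤ m2 → m2 ≤ m2plus →
      ∀ (M : Fin (d + 1) → ℕ), (∀ i, 1 ≤ M i) →
      ∀ (emb : ↥(boxDom M) → ↥(Box d ℓ k M)) (Γ : ↥(boxDom M) → ↥(Box d ℓ k M) → List ↥(Box d ℓ k M)),
        (∀ y x, blkWt ((ℓ + 1) ^ k) M (fun i => (ℓ + 1) ^ k * M i) y x ≠ 0 → pathEnd (emb y) (Γ y x) = x) →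
      ∀ (A₀ : Fin (d + 1) → ℝ) (A' : ↥(Box d ℓ k M) → ↥(Box d ℓ k M) → ℝ) (θ θ' τ : ℝ),
        IsUnit (opA d F κ ℓ k a m2 M emb Γ (constBond A₀ Subtype.val + A')).det →
        0 ≤ θ → (∀ x y : ↥(Box d ℓ k M), y.1 ∈ nbrs x.1 → |κ * A' x y| ≤ θ / ((ℓ + 1) ^ k : ℕ)) →
        0 ≤ θ' → (∀ (x z y : ↥(Box d ℓ k M)) (μ : Fin (d + 1)), z.1 = x.1 + e1 μ → y.1 = z.1 + e1 μ →
          |κ * (A' y z - A' z x)| ≤ θ' / (((ℓ + 1) ^ k : ℕ) : ℝ) ^ 2 ∧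
          |κ * (A' x z - A' z y)| ≤ θ' / (((ℓ + 1) ^ k : ℕ) : ℝ) ^ 2) →
        (∀ (x y : ↥(Box d ℓ k M)) (μ : Fin (d + 1)), y.1 = x.1 + e1 μ →
          (x.1 - e1 μ ∉ Box d ℓ k M ∨ y.1 + e1 μ ∉ Box d ℓ k M) → A' x y = 0 ∧ A' y x = 0) →
        0 ≤ τ → (∀ y x, blkWt ((ℓ + 1) ^ k) M (fun i => (ℓ + 1) ^ k * M i) y x ≠ 0 →
          |κ * lsum A' (emb y) (Γ y x)| ≤ τ) →
        ((d : ℝ) + 2) * c * (((d : ℝ) + 1) * ℓ₁ * (θ + θ') + ((d : ℝ) + 1) * ℓ₁ * θ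
          + ((d : ℝ) + 1) * ℓ₁ ^ 2 * θ ^ 2 + B1.aSeq a ((ℓ : ℝ) + 1) k * (ℓ₁ * τ * (2 + ℓ₁ * τ))) ≤ 1 / 2 →
        ∀ (p : ℝ), 1 ≤ p → ∀ f : ↥(Box d ℓ k M) × ι → ℝ,
          lpM p (greenA d F κ ℓ k a m2 M emb Γ (constBond A₀ Subtype.val + A') *ᵥ f)
              + ∑ μ, lpM p (derivA0 d F κ ℓ k M A₀ μ
                  *ᵥ (greenA d F κ ℓ k a m2 M emb Γ (constBond A₀ Subtype.val + A') *ᵥ f))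
              ≤ 2 * (((d : ℝ) + 2) * c) * lpM p f ∧
          (∀ μ : Fin (d + 1),
            lpM p (derivA d F κ ℓ k M (constBond A₀ Subtype.val + A') μ
                *ᵥ (greenA d F κ ℓ k a m2 M emb Γ (constBond A₀ Subtype.val + A') *ᵥ f))
              ≤ (1 + ℓ₁ * θ) * (2 * (((d : ℝ) + 2) * c)) * lpM p f) ∧
          (∀ μ : Fin (d + 1),
            lpM p ((greenA d F κ ℓ k a m2 M emb Γ (constBond A₀ Subtype.val + A')
                * (derivA0 d F κ ℓ k M A₀ μ)ᵀ) *ᵥ f) ≤ 2 * (((d : ℝ) + 2) * c) * lpM p f) ∧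
          ∀ μ : Fin (d + 1),
            lpM p ((greenA d F κ ℓ k a m2 M emb Γ (constBond A₀ Subtype.val + A')
                * (derivA d F κ ℓ k M (constBond A₀ Subtype.val + A') μ)ᵀ) *ᵥ f)
              ≤ (1 + ℓ₁ * θ) * (2 * (((d : ℝ) + 2) * c)) * lpM p f := by
  obtain ⟨c₁, hc₁, h₁⟩ := const_box_lp F κ d ℓ hℓ amin aplus m2plus ha
  obtain ⟨c₂, hc₂, h₂⟩ := lemma22_17_sup_box F hℓ₁ hLip κ d ℓ hℓ amin aplus m2plus ha
  refine ⟨max c₁ c₂, lt_max_of_lt_left hc₁, ?_⟩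
  intro k hk a m2 e1' e2 e3 e4 M hM emb Γ hend A₀ A' θ θ' τ hunit hθ hA' hθ' hder hbd hτ0 hτ hsm
  have hc : 0 < max c₁ c₂ := lt_max_of_lt_left hc₁
  have hn : 1 ≤ (ℓ + 1) ^ k := Nat.one_le_pow _ _ (Nat.succ_pos ℓ)
  have hL : (1 : ℝ) < (ℓ : ℝ) + 1 := by
    have : (1 : ℝ) ≤ ℓ := by exact_mod_cast hℓ
    linarith
  have hak : 0 ≤ B1.aSeq a ((ℓ : ℝ) + 1) k := (B1.aSeq_pos (lt_of_lt_of_le ha e1') hL hk).le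
  have hε : 0 ≤ ((d : ℝ) + 1) * ℓ₁ * (θ + θ') + ((d : ℝ) + 1) * ℓ₁ * θ + ((d : ℝ) + 1) * ℓ₁ ^ 2 * θ ^ 2
      + B1.aSeq a ((ℓ : ℝ) + 1) k * (ℓ₁ * τ * (2 + ℓ₁ * τ)) := by positivity
  have hres := greenA_resolvent F κ hℓ hk (lt_of_lt_of_le ha e1') e3 hM hend A₀ hunit
  have hsm' : ((Fintype.card (Fin (d + 1)) : ℝ) + 1) * max c₁ c₂ * (((d : ℝ) + 1) * ℓ₁ * (θ + θ')
      + ((d : ℝ) + 1) * ℓ₁ * θ + ((d : ℝ) + 1) * ℓ₁ ^ 2 * θ ^ 2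
      + B1.aSeq a ((ℓ : ℝ) + 1) k * (ℓ₁ * τ * (2 + ℓ₁ * τ))) ≤ 1 / 2 := by
    rw [card_dir_add_one]; exact hsm
  have hsm₂ : ((d : ℝ) + 2) * c₂ * (((d : ℝ) + 1) * ℓ₁ * (θ + θ')
      + ((d : ℝ) + 1) * ℓ₁ * θ + ((d : ℝ) + 1) * ℓ₁ ^ 2 * θ ^ 2
      + B1.aSeq a ((ℓ : ℝ) + 1) k * (ℓ₁ * τ * (2 + ℓ₁ * τ))) ≤ 1 / 2 :=
    (mul_le_mul_of_nonneg_right (mul_le_mul_of_nonneg_left (le_max_right c₁ c₂) (by positivity)) hε).trans hsm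
  have hsup := h₂ k hk a m2 e1' e2 e3 e4 M hM emb Γ hend A₀ A' θ θ' τ hunit hθ hA' hθ' hder hbd hτ0 hτ hsm₂
  have hGt : (greenA d F κ ℓ k a m2 M emb Γ (constBond A₀ Subtype.val + A'))ᵀ
      = greenA d F κ ℓ k a m2 M emb Γ (constBond A₀ Subtype.val + A') := b4Green_transpose F κ _ _ _ _ _ _ _
  have hC0 : 0 ≤ 2 * (((d : ℝ) + 2) * max c₁ c₂) := by positivity
  have hC1 : 0 ≤ (1 + ℓ₁ * θ) * (2 * (((d : ℝ) + 2) * max c₁ c₂)) := by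
    have := mul_nonneg hℓ₁ hθ
    positivity
  have hC02 : 2 * (((d : ℝ) + 2) * c₂) ≤ 2 * (((d : ℝ) + 2) * max c₁ c₂) :=
    mul_le_mul_of_nonneg_left (mul_le_mul_of_nonneg_left (le_max_right _ _) (by positivity)) zero_le_two
  -- members 1 and 2 at an arbitrary exponent `q ≥ 1`
  have main : ∀ (q : ℝ), 1 ≤ q → ∀ f : ↥(Box d ℓ k M) × ι → ℝ,
      lpM q (greenA d F κ ℓ k a m2 M emb Γ (constBond A₀ Subtype.val + A') *ᵥ f)
          + ∑ μ, lpM q (derivA0 d F κ ℓ k M A₀ μ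
              *ᵥ (greenA d F κ ℓ k a m2 M emb Γ (constBond A₀ Subtype.val + A') *ᵥ f))
          ≤ 2 * (((d : ℝ) + 2) * max c₁ c₂) * lpM q f ∧
      ∀ μ : Fin (d + 1),
        lpM q (derivA d F κ ℓ k M (constBond A₀ Subtype.val + A') μ
            *ᵥ (greenA d F κ ℓ k a m2 M emb Γ (constBond A₀ Subtype.val + A') *ᵥ f))
          ≤ (1 + ℓ₁ * θ) * (2 * (((d : ℝ) + 2) * max c₁ c₂)) * lpM q f := by
    intro q hq f
    obtain ⟨h0', hD''⟩ := h₁ k hk a m2 e1' e2 e3 e4 M hM emb Γ hend A₀ q hq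
    have h0 : ∀ Φ : ↥(Box d ℓ k M) × ι → ℝ,
        lpM q (greenA0 d F κ ℓ k a m2 M emb Γ A₀ *ᵥ Φ) ≤ max c₁ c₂ * lpM q Φ := fun Φ =>
      (h0' Φ).trans (mul_le_mul_of_nonneg_right (le_max_left _ _) (lpM_nonneg _ _))
    have hD : ∀ (μ : Fin (d + 1)) (Φ : ↥(Box d ℓ k M) × ι → ℝ),
        lpM q (derivA0 d F κ ℓ k M A₀ μ *ᵥ (greenA0 d F κ ℓ k a m2 M emb Γ A₀ *ᵥ Φ)) ≤ max c₁ c₂ * lpM q Φ :=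
      fun μ Φ => (hD'' μ Φ).trans (mul_le_mul_of_nonneg_right (le_max_left _ _) (lpM_nonneg _ _))
    have hV := firstOrderSmall_pertV_lp F hℓ₁ hLip κ hℓ hk (lt_of_lt_of_le ha e1') M emb Γ A₀ hθ hA' hθ' hder hbd
      hτ0 hτ hq
    have hD' : ∀ (μ : Fin (d + 1)) (u : ↥(Box d ℓ k M) × ι → ℝ),
        lpM q ((derivA d F κ ℓ k M (constBond A₀ Subtype.val + A') μ - derivA0 d F κ ℓ k M A₀ μ) *ᵥ u)
          ≤ ℓ₁ * θ * (lpM q u + ∑ ν', lpM q (derivA0 d F κ ℓ k M A₀ ν' *ᵥ u)) := by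
      intro μ u
      refine (covDeriv_sub_lpM_le F hℓ₁ hLip κ hn (constBond A₀ Subtype.val) hθ
        (fun x y hy => hA' x y (hy ▸ add_e1_mem_nbrs x.1 μ)) hq u).trans ?_
      exact mul_le_mul_of_nonneg_left (le_add_of_nonneg_right (sum_nonneg fun _ _ => lpM_nonneg _ _))
        (mul_nonneg hℓ₁ hθ)
    refine ⟨?_, fun μ => ?_⟩
    · have key := bootstrap (κ := Fin (d + 1)) (lpM_nonneg q) (lpM_add_le hq) hres hc.le h0 hD hV hsm' f
      rw [card_dir_add_one] at key
      exact key
    · have key := deriv_convert (κ := Fin (d + 1)) (lpM_nonneg q) (lpM_add_le hq) hres hc.le h0 hD hV hsm'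
        (mul_nonneg hℓ₁ hθ) hD' μ f
      rw [card_dir_add_one] at key
      exact key
  intro p hp f
  refine ⟨(main p hp f).1, (main p hp f).2, fun μ => ?_, fun μ => ?_⟩
  · -- member 3, `A₀`-convention: the dual of member 2 (`A₀`-convention)
    have hT : greenA d F κ ℓ k a m2 M emb Γ (constBond A₀ Subtype.val + A') * (derivA0 d F κ ℓ k M A₀ μ)ᵀ
        = (derivA0 d F κ ℓ k M A₀ μ * greenA d F κ ℓ k a m2 M emb Γ (constBond A₀ Subtype.val + A'))ᵀ := by
      rw [Matrix.transpose_mul, hGt]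
    rw [hT]
    refine lpM_transpose_le_of_rows hC0 (fun q hq Φ => ?_) (fun Φ => ?_) hp f
    · rw [← Matrix.mulVec_mulVec]
      have key := (main q hq Φ).1
      have h1 := single_le_sum (s := univ) (f := fun ν => lpM q (derivA0 d F κ ℓ k M A₀ ν
        *ᵥ (greenA d F κ ℓ k a m2 M emb Γ (constBond A₀ Subtype.val + A') *ᵥ Φ))) (fun ν _ => lpM_nonneg _ _)
        (mem_univ μ)
      have h2 : ∑ ν, lpM q (derivA0 d F κ ℓ k M A₀ ν
          *ᵥ (greenA d F κ ℓ k a m2 M emb Γ (constBond A₀ Subtype.val + A') *ᵥ Φ))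
          ≤ lpM q (greenA d F κ ℓ k a m2 M emb Γ (constBond A₀ Subtype.val + A') *ᵥ Φ)
            + ∑ ν, lpM q (derivA0 d F κ ℓ k M A₀ ν
              *ᵥ (greenA d F κ ℓ k a m2 M emb Γ (constBond A₀ Subtype.val + A') *ᵥ Φ)) :=
        le_add_of_nonneg_left (lpM_nonneg _ _)
      exact (h1.trans h2).trans key
    · rw [← Matrix.mulVec_mulVec]
      have key := (hsup Φ).1
      have h1 := single_le_sum (s := univ) (f := fun ν => supN (derivA0 d F κ ℓ k M A₀ ν
        *ᵥ (greenA d F κ ℓ k a m2 M emb Γ (constBond A₀ Subtype.val + A') *ᵥ Φ))) (fun ν _ => supN_nonneg _)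
        (mem_univ μ)
      have h2 : ∑ ν, supN (derivA0 d F κ ℓ k M A₀ ν
          *ᵥ (greenA d F κ ℓ k a m2 M emb Γ (constBond A₀ Subtype.val + A') *ᵥ Φ))
          ≤ supN (greenA d F κ ℓ k a m2 M emb Γ (constBond A₀ Subtype.val + A') *ᵥ Φ)
            + ∑ ν, supN (derivA0 d F κ ℓ k M A₀ ν
              *ᵥ (greenA d F κ ℓ k a m2 M emb Γ (constBond A₀ Subtype.val + A') *ᵥ Φ)) :=
        le_add_of_nonneg_left (supN_nonneg _)
      exact ((h1.trans h2).trans key).trans (mul_le_mul_of_nonneg_right hC02 (supN_nonneg _))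
  · -- member 3, `Ã`-convention: the dual of member 2 (`Ã`-convention)
    have hT : greenA d F κ ℓ k a m2 M emb Γ (constBond A₀ Subtype.val + A')
        * (derivA d F κ ℓ k M (constBond A₀ Subtype.val + A') μ)ᵀ
        = (derivA d F κ ℓ k M (constBond A₀ Subtype.val + A') μ
            * greenA d F κ ℓ k a m2 M emb Γ (constBond A₀ Subtype.val + A'))ᵀ := by
      rw [Matrix.transpose_mul, hGt]
    rw [hT]
    refine lpM_transpose_le_of_rows hC1 (fun q hq Φ => ?_) (fun Φ => ?_) hp f
    · rw [← Matrix.mulVec_mulVec]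
      exact (main q hq Φ).2 μ
    · rw [← Matrix.mulVec_mulVec]
      refine ((hsup Φ).2 μ).trans (mul_le_mul_of_nonneg_right ?_ (supN_nonneg _))
      exact mul_le_mul_of_nonneg_left hC02 (add_nonneg zero_le_one (mul_nonneg hℓ₁ hθ))

/-! ## §8 THE STAIRCASE SPECIALISATION: INVERTIBILITY AND CONTOUR HYPOTHESES DISCHARGED -/

/-- **LEMMA 2.2 (2.17), EVERY ROW `q = p ∈ [1,∞)`, ALL THREE MEMBERS `n ≤ 1` (both derivative conventions), FOR
[B4]'s `G_k(□,Ã)` ON A FINE BOX WITH THE STAIRCASE CONTOURS — ALL OPERATOR-SIDE HYPOTHESES DISCHARGED** (as in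
`B4Lemma22SupStair.lemma22_17_sup_stair` / `B4Lemma22L1Stair.lemma22_17_l1_deriv_stair`: invertibility from
`B4Lower18Regular.green_box_l2_bound` under `ℓ²θ²(d+1)(1 + a_k(d+1)) ≤ min(2,a_k)/4`, contour ends from
`stairContour_end`, `τ = (d+1)θ` from `B4Lemma22SupStair.stair_lsum_le`): for every `p ≥ 1` and every `f`,
`‖Gf‖_p + Σ_μ‖D^η_{A₀,μ}Gf‖_p ≤ 2(d+2)c‖f‖_p`, `‖D^η_{Ã,μ}Gf‖_p ≤ (1+ℓ₁θ)·2(d+2)c‖f‖_p`,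
`‖G(D^η_{A₀,μ})ᵀf‖_p ≤ 2(d+2)c‖f‖_p`, `‖G(D^η_{Ã,μ})ᵀf‖_p ≤ (1+ℓ₁θ)·2(d+2)c‖f‖_p`.  Together with
`B4Lemma22SupStair.lemma22_17_sup_stair` and `B4Lemma22L1Stair.lemma22_17_l1_deriv_stair` (the row `q = p = ∞`):
all three members `n ≤ 1` of (2.17) on the whole diagonal `q = p ∈ [1,∞]`.
[cite: Balaban1983RegularityDecay, Lemma 2.2 (2.17) p. 578; proof pp. 579–583] -/
theorem lemma22_17_lp_stair (F : OrthFlow ι) {ℓ₁ : ℝ} (hℓ₁ : 0 ≤ ℓ₁)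
    (hLip : ∀ t (v : ι → ℝ), ((F.U t - 1) *ᵥ v) ⬝ᵥ ((F.U t - 1) *ᵥ v) ≤ (ℓ₁ * t) ^ 2 * (v ⬝ᵥ v))
    (κ : ℝ) (d ℓ : ℕ) (hℓ : 1 ≤ ℓ) (amin aplus m2plus : ℝ) (ha : 0 < amin) :
    ∃ c : ℝ, 0 < c ∧ ∀ (k : ℕ), 1 ≤ k → ∀ (hn : 1 ≤ (ℓ + 1) ^ k) (a m2 : ℝ),
      amin ≤ a → a ≤ aplus → 0 ≤ m2 → m2 ≤ m2plus →
      ∀ (M : Fin (d + 1) → ℕ), (∀ i, 1 ≤ M i) →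
      ∀ (A₀ : Fin (d + 1) → ℝ) (A' : ↥(Box d ℓ k M) → ↥(Box d ℓ k M) → ℝ) (θ θ' : ℝ),
        0 ≤ θ → (∀ x y : ↥(Box d ℓ k M), y.1 ∈ nbrs x.1 → |κ * A' x y| ≤ θ / ((ℓ + 1) ^ k : ℕ)) →
        0 ≤ θ' → (∀ (x z y : ↥(Box d ℓ k M)) (μ : Fin (d + 1)), z.1 = x.1 + e1 μ → y.1 = z.1 + e1 μ →
          |κ * (A' y z - A' z x)| ≤ θ' / (((ℓ + 1) ^ k : ℕ) : ℝ) ^ 2 ∧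
          |κ * (A' x z - A' z y)| ≤ θ' / (((ℓ + 1) ^ k : ℕ) : ℝ) ^ 2) →
        (∀ (x y : ↥(Box d ℓ k M)) (μ : Fin (d + 1)), y.1 = x.1 + e1 μ →
          (x.1 - e1 μ ∉ Box d ℓ k M ∨ y.1 + e1 μ ∉ Box d ℓ k M) → A' x y = 0 ∧ A' y x = 0) →
        ℓ₁ ^ 2 * θ ^ 2 * ((d : ℝ) + 1) * (1 + B1.aSeq a ((ℓ : ℝ) + 1) k * ((d : ℝ) + 1))
          ≤ min 2 (B1.aSeq a ((ℓ : ℝ) + 1) k) / 4 →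
        ((d : ℝ) + 2) * c * (((d : ℝ) + 1) * ℓ₁ * (θ + θ') + ((d : ℝ) + 1) * ℓ₁ * θ
          + ((d : ℝ) + 1) * ℓ₁ ^ 2 * θ ^ 2
          + B1.aSeq a ((ℓ : ℝ) + 1) k * (ℓ₁ * (((d : ℝ) + 1) * θ) * (2 + ℓ₁ * (((d : ℝ) + 1) * θ)))) ≤ 1 / 2 →
        ∀ (p : ℝ), 1 ≤ p → ∀ f : ↥(Box d ℓ k M) × ι → ℝ,
          lpM p (greenA d F κ ℓ k a m2 M (baseEmb hn M) (stairContour hn M) (constBond A₀ Subtype.val + A')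
              *ᵥ f)
              + ∑ μ, lpM p (derivA0 d F κ ℓ k M A₀ μ
                  *ᵥ (greenA d F κ ℓ k a m2 M (baseEmb hn M) (stairContour hn M) (constBond A₀ Subtype.val + A')
                      *ᵥ f))
              ≤ 2 * (((d : ℝ) + 2) * c) * lpM p f ∧
          (∀ μ : Fin (d + 1),
            lpM p (derivA d F κ ℓ k M (constBond A₀ Subtype.val + A') μ
                *ᵥ (greenA d F κ ℓ k a m2 M (baseEmb hn M) (stairContour hn M) (constBond A₀ Subtype.val + A')
                    *ᵥ f))
              ≤ (1 + ℓ₁ * θ) * (2 * (((d : ℝ) + 2) * c)) * lpM p f) ∧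
          (∀ μ : Fin (d + 1),
            lpM p ((greenA d F κ ℓ k a m2 M (baseEmb hn M) (stairContour hn M) (constBond A₀ Subtype.val + A')
                * (derivA0 d F κ ℓ k M A₀ μ)ᵀ) *ᵥ f) ≤ 2 * (((d : ℝ) + 2) * c) * lpM p f) ∧
          ∀ μ : Fin (d + 1),
            lpM p ((greenA d F κ ℓ k a m2 M (baseEmb hn M) (stairContour hn M) (constBond A₀ Subtype.val + A')
                * (derivA d F κ ℓ k M (constBond A₀ Subtype.val + A') μ)ᵀ) *ᵥ f)
              ≤ (1 + ℓ₁ * θ) * (2 * (((d : ℝ) + 2) * c)) * lpM p f := by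
  obtain ⟨c, hc, h⟩ := lemma22_17_lp_box F hℓ₁ hLip κ d ℓ hℓ amin aplus m2plus ha
  refine ⟨c, hc, ?_⟩
  intro k hk hn a m2 e1' e2 e3 e4 M hM A₀ A' θ θ' hθ hA' hθ' hder hbd hsm2 hsm p hp f
  have hL : (1 : ℝ) < (ℓ : ℝ) + 1 := by
    have : (1 : ℝ) ≤ ℓ := by exact_mod_cast hℓ
    linarith
  have hak : 0 < B1.aSeq a ((ℓ : ℝ) + 1) k := B1.aSeq_pos (lt_of_lt_of_le ha e1') hL hk
  have hpos : 0 < min 2 (B1.aSeq a ((ℓ : ℝ) + 1) k) / 4 + m2 := by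
    have : 0 < min 2 (B1.aSeq a ((ℓ : ℝ) + 1) k) := lt_min two_pos hak
    linarith
  have hAd : ∀ x y : ↥(Box d ℓ k M), y.1 ∈ nbrs x.1 →
      |κ * ((constBond A₀ Subtype.val + A' : ↥(Box d ℓ k M) → ↥(Box d ℓ k M) → ℝ) x y
        - constBond A₀ Subtype.val x y)| ≤ θ / ((ℓ + 1) ^ k : ℕ) := by
    intro x y hxy
    simpa only [Pi.add_apply, add_sub_cancel_left] using hA' x y hxy
  have hunit := (green_box_l2_bound F hℓ₁ hLip κ hn hak.le hpos M A₀ (A := constBond A₀ Subtype.val + A') hθ hAd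
    hsm2 0).1
  have hτ : ∀ y x, blkWt ((ℓ + 1) ^ k) M (fun i => (ℓ + 1) ^ k * M i) y x ≠ 0 →
      |κ * lsum A' (baseEmb hn M y) (stairContour hn M y x)| ≤ ((d : ℝ) + 1) * θ :=
    fun y x _ => stair_lsum_le κ hn M hθ hA' y x
  have hτ0 : 0 ≤ ((d : ℝ) + 1) * θ := by positivity
  exact h k hk a m2 e1' e2 e3 e4 M hM (baseEmb hn M) (stairContour hn M) (fun y x hw => stairContour_end hn M y x hw)
    A₀ A' θ θ' (((d : ℝ) + 1) * θ) hunit hθ hA' hθ' hder hbd hτ0 hτ hsm p hp f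

end Assembly

end

end Literature.MathematicalPhysics.QuantumFieldTheory.Balaban1983to89.B4Lemma22LpStair
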